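import Literature.Analysis.PDE.InteriorW16Bound
import HarnessLib

/-!
# Decay bootstrap with one derivative of the source: the `L⁶` top level

Analysis/PDE support file on the discharge path of
`Literature.Geometry.Lorentzian.exists_ricciVariation_negativeMass_of_massZero` (Schoen–Yau 1979,
proof of Thm. 2: Lemma 3.3 along `ds²_t = ds² + t Ric`, whose scalar curvature `R_t` has one
controlled derivative only). Companion of `DecayBootstrap.lean` (`decay_bootstrap`: pointwise
decay of `u, ∂u, ∂²u` for classical solutions of `Σ aₖₗ∂ₗ∂ₖu + Σ βₖ∂ₖu + cu = g` on an
exterior region of `ℝ³`, from the interior `L²` theory, requiring `g, ∂g, ∂²g` in `L²` on the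
balls `B̄(x, θ|x|)`): here the top level is the `W^{2,6} ⊂ C¹` estimate of
`InteriorW16Bound.lean`, so that only `g` and `∂g` are needed (the latter pointwise):

* `level_two_six` — on one ball: the second derivatives `∂ⱼ∂ₘu(x)` at the centre are bounded by
  `C √σ₁` times `L⁶(B̄(x,σ₁))` norms of `∂∂u, ∂u, u, ∂ₘg` (the Laplacian inequality for `∂ₘu`,
  `abs_laplacian_fderiv_le`, fed into `enorm_fderiv_le_of_laplacian_le_six`);
* `decay_bootstrap_six` — **the bootstrap**: under `Σ|a − δ| ≤ K r⁻²`, `Σ|β| ≤ K r⁻³`,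
  `|c| ≤ K r⁻⁴`, first partials of the coefficients `≤ K r⁻³`, `∫_{B̄(x,θ|x|)} g² ≤ K|x|⁻⁵`,
  `∫ (∂g)² ≤ K|x|⁻⁷` and `|∂g| ≤ K |y|⁻⁵` pointwise, every bound
  `∫_{B̄(x,θ|x|)} u² ≤ K₀|x|^q` (`q ≥ −1`) yields `u(x)² ≲ |x|^{q−3}`, `(∂ₘu(x))² ≲ |x|^{q−5}`
  and `(∂ₙ∂ₘu(x))² ≲ |x|^{q−7}` far out (levels zero and one verbatim from
  `DecayBootstrap.lean`, level two from `level_two_six` and the Sobolev inequality on balls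
  `eLpNorm_six_le_of_ball`).

Everything is proved; nothing is defined and no named fact is introduced.

## References

* R. Schoen, S.-T. Yau, *On the proof of the positive mass conjecture in general relativity*,
  Comm. Math. Phys. 65 (1979) 45–76, Lemma 3.2, (3.9)–(3.11) and (3.19)–(3.20). [SchoenYauPMT1979]
* D. Gilbarg, N. S. Trudinger, *Elliptic partial differential equations of second order*,
  Springer 2001, Thm. 9.11, Thm. 7.10, Thm. 7.17. [GilbargTrudinger2001]
-/

noncomputable section

set_option maxSynthPendingDepth 3

open MeasureTheory Set Filter Topology Real Metric Bornology Module
open scoped ENNReal NNReal Laplacian ContDiff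

namespace Literature.Analysis.PDE

open Literature.Analysis.FluidPDE Literature.Analysis.FunctionSpaces
open Literature.Geometry.Lorentzian (E3)

/-! ### Level two on one ball, `L⁶` version -/

section LevelTwo

set_option maxHeartbeats 800000 in
/-- **Level two on one ball with one derivative of the source.** There are `ε₁ > 0` and `C`
such that, for a classical solution of `Σ aₖₗ∂ₗ∂ₖu + Σ βₖ∂ₖu + cu = g` on an open
`U ⊇ B̄(x,σ₁)` with smooth coefficients, `Σ|aₖₗ − δₖₗ| ≤ ε ≤ ε₁`, `Σ|βₖ| ≤ L`, `|c| ≤ L²` and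
first partials of the coefficients bounded by `Λ₁` on the ball, for all `m, j`:

  `|∂ⱼ∂ₘu(x)| ≤ C √σ₁ ((L + σ₁⁻¹) Σₗ ‖∂ₗ∂ₘu‖₆ + (L² + σ₁⁻²) ‖∂ₘu‖₆ + ‖∂ₘg‖₆`
  `                + Λ₁ (Σₖₗ ‖∂ₗ∂ₖu‖₆ + Σₖ ‖∂ₖu‖₆ + ‖u‖₆))`,

all `L⁶` norms over `B̄(x,σ₁)` (in `ℝ≥0∞`): the Laplacian inequality for `∂ₘu`
(`abs_laplacian_fderiv_le`) and `enorm_fderiv_le_of_laplacian_le_six`.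
[cite: GilbargTrudinger2001, Thm. 9.11 and Thm. 7.17 (classical case)] -/
theorem level_two_six (b : OrthonormalBasis (Fin 3) ℝ E3) :
    ∃ ε₁ C : ℝ, 0 < ε₁ ∧ 0 ≤ C ∧ ∀ (U : Set E3) (x : E3) (σ₁ : ℝ) (u g : E3 → ℝ)
      (a : Fin 3 → Fin 3 → E3 → ℝ) (β : Fin 3 → E3 → ℝ) (c : E3 → ℝ) (ε L Λ₁ : ℝ),
      IsOpen U → 0 < σ₁ → closedBall x σ₁ ⊆ U → ContDiffOn ℝ ∞ u U → ContDiffOn ℝ ∞ g U →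
      (∀ k l, ContDiffOn ℝ ∞ (a k l) U) → (∀ k, ContDiffOn ℝ ∞ (β k) U) → ContDiffOn ℝ ∞ c U →
      0 ≤ ε → ε ≤ ε₁ → 0 ≤ L → 0 ≤ Λ₁ →
      (∀ z ∈ U, ∑ k, ∑ l, a k l z * fderiv ℝ (fun z' => fderiv ℝ u z' (b k)) z (b l)
        + ∑ k, β k z * fderiv ℝ u z (b k) + c z * u z = g z) →
      (∀ y ∈ closedBall x σ₁, ∑ k, ∑ l, |a k l y - if k = l then 1 else 0| ≤ ε) →
      (∀ y ∈ closedBall x σ₁, ∑ k, |β k y| ≤ L) →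
      (∀ y ∈ closedBall x σ₁, |c y| ≤ L ^ 2) →
      (∀ y ∈ closedBall x σ₁, ∀ i, (∀ k l, |fderiv ℝ (a k l) y (b i)| ≤ Λ₁) ∧
        (∀ k, |fderiv ℝ (β k) y (b i)| ≤ Λ₁) ∧ |fderiv ℝ c y (b i)| ≤ Λ₁) →
      ∀ m j, ‖fderiv ℝ (fun z ↦ fderiv ℝ u z (b m)) x (b j)‖ₑ ≤
        ENNReal.ofReal (C * Real.sqrt σ₁) *
          (ENNReal.ofReal (L + σ₁⁻¹) * ∑ l, eLpNorm (fun y ↦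
              fderiv ℝ (fun z ↦ fderiv ℝ u z (b m)) y (b l)) 6
              ((volume : Measure E3).restrict (closedBall x σ₁))
            + ENNReal.ofReal (L ^ 2 + σ₁⁻¹ ^ 2) * eLpNorm (fun y ↦ fderiv ℝ u y (b m)) 6
              ((volume : Measure E3).restrict (closedBall x σ₁))
            + (eLpNorm (fun y ↦ fderiv ℝ g y (b m)) 6
                ((volume : Measure E3).restrict (closedBall x σ₁))
              + ENNReal.ofReal Λ₁ *
                (∑ k, ∑ l, eLpNorm (fun y ↦ fderiv ℝ (fun z ↦ fderiv ℝ u z (b k)) y (b l)) 6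
                    ((volume : Measure E3).restrict (closedBall x σ₁))
                  + ∑ k, eLpNorm (fun y ↦ fderiv ℝ u y (b k)) 6
                    ((volume : Measure E3).restrict (closedBall x σ₁))
                  + eLpNorm u 6 ((volume : Measure E3).restrict (closedBall x σ₁))))) := by
  obtain ⟨ε₁, C, hε₁, hC, hW⟩ := enorm_fderiv_le_of_laplacian_le_six b
  refine ⟨ε₁, C, hε₁, hC, fun U x σ₁ u g a β c ε L Λ₁ hU hσ₁ hxU hu hg has hβs hcs hε0 hε hL hΛ₁
    heq ha hβ hc hΛ m j ↦ ?_⟩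
  set μ : Measure E3 := (volume : Measure E3).restrict (closedBall x σ₁) with hμ
  -- the derivative `v = ∂ₘ u` and the error function `G`
  set v : E3 → ℝ := fun z ↦ fderiv ℝ u z (b m) with hv
  have hvs : ContDiffOn ℝ ∞ v U := contDiffOn_fderiv_apply_of_isOpen hU hu (b m)
  set G : E3 → ℝ := fun y ↦ |fderiv ℝ g y (b m)| +
      Λ₁ * (∑ k, ∑ l, |fderiv ℝ (fun z ↦ fderiv ℝ u z (b k)) y (b l)|
        + ∑ k, |fderiv ℝ u y (b k)| + |u y|) with hG
  -- continuity on the ball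
  have hu3 : ContDiffOn ℝ 3 u U := hu.of_le (by norm_cast)
  have cu0 : ContinuousOn u (closedBall x σ₁) := hu.continuousOn.mono hxU
  have hu1 : ∀ i, ContDiffOn ℝ ∞ (fun y ↦ fderiv ℝ u y (b i)) U := fun i ↦
    contDiffOn_fderiv_apply_of_isOpen hU hu (b i)
  have hu2 : ∀ i j, ContDiffOn ℝ ∞ (fun y ↦ fderiv ℝ (fun z ↦ fderiv ℝ u z (b i)) y (b j)) U :=
    fun i j ↦ contDiffOn_fderiv_apply_of_isOpen hU (hu1 i) (b j)
  have cu1 : ∀ i, ContinuousOn (fun y ↦ fderiv ℝ u y (b i)) (closedBall x σ₁) := fun i ↦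
    (hu1 i).continuousOn.mono hxU
  have cu2 : ∀ i j, ContinuousOn (fun y ↦ fderiv ℝ (fun z ↦ fderiv ℝ u z (b i)) y (b j))
      (closedBall x σ₁) := fun i j ↦ (hu2 i j).continuousOn.mono hxU
  have hg1 : ContDiffOn ℝ ∞ (fun y ↦ fderiv ℝ g y (b m)) U := contDiffOn_fderiv_apply_of_isOpen hU hg (b m)
  have cg1 : ContinuousOn (fun y ↦ fderiv ℝ g y (b m)) (closedBall x σ₁) := hg1.continuousOn.mono hxU
  have hGc : ContinuousOn G (closedBall x σ₁) := by
    simp only [hG]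
    refine (continuous_abs.comp_continuousOn cg1).add (continuousOn_const.mul ((?_ : ContinuousOn _ _).add
      (continuous_abs.comp_continuousOn cu0)))
    exact (continuousOn_finsetSum _ fun k _ ↦ continuousOn_finsetSum _ fun l _ ↦
      continuous_abs.comp_continuousOn (cu2 k l)).add
      (continuousOn_finsetSum _ fun k _ ↦ continuous_abs.comp_continuousOn (cu1 k))
  -- the Laplacian inequality for `v`
  have hΔ : ∀ y ∈ closedBall x σ₁, |(Δ v) y| ≤
      ε * Real.sqrt (∑ k, ∑ l, (fderiv ℝ (fun z => fderiv ℝ v z (b k)) y (b l)) ^ 2)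
        + L * Real.sqrt (∑ k, (fderiv ℝ v y (b k)) ^ 2) + L ^ 2 * |v y| + G y := by
    intro y hy
    have hyU : y ∈ U := hxU hy
    have hUy : U ∈ 𝓝 y := hU.mem_nhds hyU
    have had : ∀ k l, DifferentiableAt ℝ (a k l) y := fun k l ↦
      ((has k l).contDiffAt hUy).differentiableAt (by simp)
    have hβd : ∀ k, DifferentiableAt ℝ (β k) y := fun k ↦
      ((hβs k).contDiffAt hUy).differentiableAt (by simp)
    have hcd : DifferentiableAt ℝ c y := (hcs.contDiffAt hUy).differentiableAt (by simp)
    obtain ⟨h1, h2, h3⟩ := hΛ y hy m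
    have h := abs_laplacian_fderiv_le b hU hyU hu3 had hβd hcd heq (ha y hy) (hβ y hy) m h1 h2 h3
    have hcv : |c y| * |fderiv ℝ u y (b m)| ≤ L ^ 2 * |v y| :=
      mul_le_mul_of_nonneg_right (hc y hy) (abs_nonneg _)
    simp only [hv, hG] at h hcv ⊢
    linarith
  -- the `W^{2,6}` estimate
  have hx : x ∈ closedBall x (σ₁ / 4) := mem_closedBall_self (by positivity)
  have hmain := hW U v G x σ₁ ε L hU hxU hvs hσ₁ hε0 hε hL hGc hΔ x hx j
  refine hmain.trans ?_
  refine mul_le_mul' le_rfl (add_le_add le_rfl ?_)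
  -- split `‖G‖₆`
  have m_g : AEStronglyMeasurable (fun y ↦ |fderiv ℝ g y (b m)|) μ :=
    (continuous_abs.comp_continuousOn cg1).aestronglyMeasurable measurableSet_closedBall
  have m_2 : ∀ k l, AEStronglyMeasurable (fun y ↦ |fderiv ℝ (fun z ↦ fderiv ℝ u z (b k)) y (b l)|) μ :=
    fun k l ↦ (continuous_abs.comp_continuousOn (cu2 k l)).aestronglyMeasurable measurableSet_closedBall
  have m_1 : ∀ k, AEStronglyMeasurable (fun y ↦ |fderiv ℝ u y (b k)|) μ := fun k ↦
    (continuous_abs.comp_continuousOn (cu1 k)).aestronglyMeasurable measurableSet_closedBall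
  have m_0 : AEStronglyMeasurable (fun y ↦ |u y|) μ :=
    (continuous_abs.comp_continuousOn cu0).aestronglyMeasurable measurableSet_closedBall
  have m_22 : AEStronglyMeasurable (fun y ↦ ∑ k, ∑ l, |fderiv ℝ (fun z ↦ fderiv ℝ u z (b k)) y (b l)|) μ :=
    Finset.aestronglyMeasurable_fun_sum _ fun k _ ↦ Finset.aestronglyMeasurable_fun_sum _ fun l _ ↦ m_2 k l
  have m_11 : AEStronglyMeasurable (fun y ↦ ∑ k, |fderiv ℝ u y (b k)|) μ :=
    Finset.aestronglyMeasurable_fun_sum _ fun k _ ↦ m_1 k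
  have e_norm : ∀ (F : E3 → ℝ), eLpNorm (fun y ↦ |F y|) 6 μ = eLpNorm F 6 μ := fun F ↦
    eLpNorm_congr_norm_ae (ae_of_all _ fun y ↦ by simp)
  -- sums of functions versus functions of sums
  have e22 : eLpNorm (fun y ↦ ∑ k, ∑ l, |fderiv ℝ (fun z ↦ fderiv ℝ u z (b k)) y (b l)|) 6 μ ≤
      ∑ k, ∑ l, eLpNorm (fun y ↦ fderiv ℝ (fun z ↦ fderiv ℝ u z (b k)) y (b l)) 6 μ := by
    have hfun : (fun y ↦ ∑ k, ∑ l, |fderiv ℝ (fun z ↦ fderiv ℝ u z (b k)) y (b l)|) =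
        ∑ k, ∑ l, fun y ↦ |fderiv ℝ (fun z ↦ fderiv ℝ u z (b k)) y (b l)| := by
      funext y; simp only [Finset.sum_apply]
    rw [hfun]
    refine (eLpNorm_sum_le (fun k _ ↦ Finset.aestronglyMeasurable_sum _ fun l _ ↦ m_2 k l)
      (by norm_num)).trans (Finset.sum_le_sum fun k _ ↦ ?_)
    refine (eLpNorm_sum_le (fun l _ ↦ m_2 k l) (by norm_num)).trans (Finset.sum_le_sum fun l _ ↦ ?_)
    exact (e_norm _).le
  have e11 : eLpNorm (fun y ↦ ∑ k, |fderiv ℝ u y (b k)|) 6 μ ≤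
      ∑ k, eLpNorm (fun y ↦ fderiv ℝ u y (b k)) 6 μ := by
    have hfun : (fun y ↦ ∑ k, |fderiv ℝ u y (b k)|) = ∑ k, fun y ↦ |fderiv ℝ u y (b k)| := by
      funext y; simp only [Finset.sum_apply]
    rw [hfun]
    refine (eLpNorm_sum_le (fun k _ ↦ m_1 k) (by norm_num)).trans (Finset.sum_le_sum fun k _ ↦ ?_)
    exact (e_norm _).le
  calc eLpNorm G 6 μ
      = eLpNorm ((fun y ↦ |fderiv ℝ g y (b m)|) + fun y ↦
          Λ₁ * (∑ k, ∑ l, |fderiv ℝ (fun z ↦ fderiv ℝ u z (b k)) y (b l)|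
            + ∑ k, |fderiv ℝ u y (b k)| + |u y|)) 6 μ := by rfl
    _ ≤ eLpNorm (fun y ↦ |fderiv ℝ g y (b m)|) 6 μ + eLpNorm (fun y ↦
          Λ₁ * (∑ k, ∑ l, |fderiv ℝ (fun z ↦ fderiv ℝ u z (b k)) y (b l)|
            + ∑ k, |fderiv ℝ u y (b k)| + |u y|)) 6 μ :=
        eLpNorm_add_le m_g (((m_22.add m_11).add m_0).const_mul _) (by norm_num)
    _ ≤ eLpNorm (fun y ↦ fderiv ℝ g y (b m)) 6 μ + ENNReal.ofReal Λ₁ *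
          (∑ k, ∑ l, eLpNorm (fun y ↦ fderiv ℝ (fun z ↦ fderiv ℝ u z (b k)) y (b l)) 6 μ
            + ∑ k, eLpNorm (fun y ↦ fderiv ℝ u y (b k)) 6 μ + eLpNorm u 6 μ) := by
        refine add_le_add (e_norm _).le ?_
        rw [show (fun y ↦ Λ₁ * (∑ k, ∑ l, |fderiv ℝ (fun z ↦ fderiv ℝ u z (b k)) y (b l)|
            + ∑ k, |fderiv ℝ u y (b k)| + |u y|)) = Λ₁ • ((fun y ↦ ∑ k, ∑ l,
              |fderiv ℝ (fun z ↦ fderiv ℝ u z (b k)) y (b l)|) + (fun y ↦ ∑ k, |fderiv ℝ u y (b k)|)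
              + fun y ↦ |u y|) from rfl, eLpNorm_const_smul, Real.enorm_eq_ofReal hΛ₁]
        refine mul_le_mul' le_rfl ?_
        calc eLpNorm ((fun y ↦ ∑ k, ∑ l, |fderiv ℝ (fun z ↦ fderiv ℝ u z (b k)) y (b l)|)
              + (fun y ↦ ∑ k, |fderiv ℝ u y (b k)|) + fun y ↦ |u y|) 6 μ
            ≤ eLpNorm ((fun y ↦ ∑ k, ∑ l, |fderiv ℝ (fun z ↦ fderiv ℝ u z (b k)) y (b l)|)
              + (fun y ↦ ∑ k, |fderiv ℝ u y (b k)|)) 6 μ + eLpNorm (fun y ↦ |u y|) 6 μ :=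
              eLpNorm_add_le (m_22.add m_11) m_0 (by norm_num)
          _ ≤ eLpNorm (fun y ↦ ∑ k, ∑ l, |fderiv ℝ (fun z ↦ fderiv ℝ u z (b k)) y (b l)|) 6 μ
              + eLpNorm (fun y ↦ ∑ k, |fderiv ℝ u y (b k)|) 6 μ + eLpNorm (fun y ↦ |u y|) 6 μ :=
              add_le_add (eLpNorm_add_le m_22 m_11 (by norm_num)) le_rfl
          _ ≤ _ := add_le_add (add_le_add e22 e11) (e_norm _).le

end LevelTwo

/-! ### Level two at a point of the exterior region -/

section LevelTwoDecay

/-- `L⁶` seminorm on a closed ball of `ℝ³` from a pointwise bound: if `|F| ≤ B` on `B̄(x,s)`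
(`s ≥ 0`), then `‖F‖_{L⁶(B̄(x,s))} ≤ V₁^{1/6} B √s`, `V₁` the volume of the unit ball. [folklore] -/
theorem eLpNorm_six_restrict_le_of_bound {F : E3 → ℝ} {x : E3} {s B : ℝ} (hs : 0 ≤ s) (hB : 0 ≤ B)
    (hF : ∀ y ∈ closedBall x s, |F y| ≤ B) :
    eLpNorm F 6 ((volume : Measure E3).restrict (closedBall x s)) ≤
      (volume (ball (0 : E3) 1)) ^ (6 : ℝ)⁻¹ * ENNReal.ofReal (B * Real.sqrt s) := by
  have hae : ∀ᵐ y ∂((volume : Measure E3).restrict (closedBall x s)), ‖F y‖ ≤ B :=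
    (ae_restrict_iff' measurableSet_closedBall).2 (ae_of_all _ fun y hy ↦ by
      rw [Real.norm_eq_abs]; exact hF y hy)
  refine (eLpNorm_le_of_ae_bound hae).trans ?_
  rw [Measure.restrict_apply_univ, Measure.addHaar_closedBall _ _ hs, finrank_euclideanSpace_fin,
    ENNReal.toReal_ofNat, ENNReal.mul_rpow_of_nonneg _ _ (by positivity),
    ENNReal.ofReal_rpow_of_nonneg (by positivity) (by positivity)]
  have h36 : (s ^ 3) ^ (6 : ℝ)⁻¹ = Real.sqrt s := by
    rw [← Real.rpow_natCast s 3, ← Real.rpow_mul hs, Real.sqrt_eq_rpow]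
    norm_num
  rw [h36, ENNReal.ofReal_mul hB]
  refine le_of_eq ?_
  ring

set_option maxHeartbeats 1600000 in
/-- **Level two at one point, with one derivative of the source.** There is `ε₁ > 0` and, for
all admissible constants `θ, M, K, K₀, A₁, A₂, A₃`, a constant `A₅` such that: if `u` solves
`Σ aₖₗ∂ₗ∂ₖu + Σ βₖ∂ₖu + cu = g` classically on an open `U ⊇ B̄(x, θr/4)` (`r ≥ 1`), with
`Σ|a − δ| ≤ ε ≤ ε₁`, `Σ|β| ≤ M/(θr)`, `|c| ≤ (M/(θr))²`, first partials of the coefficients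
`≤ 3K r⁻³` and `|∂ₘg| ≤ K r⁻⁵` on `B̄(x, θr/8)`, and with the level-one energies
`∫_{B̄(x,θr/4)} ΣΣ(∂ⱼ∂ᵢ∂ₘu)² ≤ A₃ r^{q−6}`, `∫ ΣΣ(∂ⱼ∂ᵢu)² ≤ A₂ r^{q−4}`, `∫ Σ(∂ᵢu)² ≤ A₁ r^{q−2}`,
`∫ u² ≤ K₀ r^q` (`q ≥ −1`), then `(∂ₙ∂ₘu(x))² ≤ A₅ r^{q−7}` (`level_two_six`, the Sobolev
inequality on balls `eLpNorm_six_le_of_ball`, and bookkeeping of the powers of `r`).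
[cite: SchoenYauPMT1979, proof of Lemma 3.2, (3.19)–(3.20)] -/
theorem level_two_six_decay (b : OrthonormalBasis (Fin 3) ℝ E3) :
    ∃ ε₁ : ℝ, 0 < ε₁ ∧ ∀ (θ M K K₀ A₁ A₂ A₃ : ℝ), 0 < θ → 1 ≤ M → 0 ≤ K → 0 ≤ K₀ → 0 ≤ A₁ →
      0 ≤ A₂ → 0 ≤ A₃ → ∃ A₅ : ℝ, 0 ≤ A₅ ∧ ∀ (U : Set E3) (x : E3) (r q ε : ℝ) (u g : E3 → ℝ)
      (a : Fin 3 → Fin 3 → E3 → ℝ) (β : Fin 3 → E3 → ℝ) (c : E3 → ℝ),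
      IsOpen U → 1 ≤ r → -1 ≤ q → 0 ≤ ε → ε ≤ ε₁ → closedBall x (θ * r / 4) ⊆ U →
      ContDiffOn ℝ ∞ u U → ContDiffOn ℝ ∞ g U → (∀ k l, ContDiffOn ℝ ∞ (a k l) U) →
      (∀ k, ContDiffOn ℝ ∞ (β k) U) → ContDiffOn ℝ ∞ c U →
      (∀ z ∈ U, ∑ k, ∑ l, a k l z * fderiv ℝ (fun z' => fderiv ℝ u z' (b k)) z (b l)
        + ∑ k, β k z * fderiv ℝ u z (b k) + c z * u z = g z) →
      (∀ y ∈ closedBall x (θ * r / 8), ∑ k, ∑ l, |a k l y - if k = l then 1 else 0| ≤ ε) →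
      (∀ y ∈ closedBall x (θ * r / 8), ∑ k, |β k y| ≤ M / (θ * r)) →
      (∀ y ∈ closedBall x (θ * r / 8), |c y| ≤ (M / (θ * r)) ^ 2) →
      (∀ y ∈ closedBall x (θ * r / 8), ∀ i, (∀ k l, |fderiv ℝ (a k l) y (b i)| ≤ 3 * K * r ^ (-3 : ℝ)) ∧
        (∀ k, |fderiv ℝ (β k) y (b i)| ≤ 3 * K * r ^ (-3 : ℝ)) ∧
        |fderiv ℝ c y (b i)| ≤ 3 * K * r ^ (-3 : ℝ)) →
      (∀ m, ∀ y ∈ closedBall x (θ * r / 8), |fderiv ℝ g y (b m)| ≤ K * r ^ (-5 : ℝ)) →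
      (∀ m, ∫ y in closedBall x (θ * r / 4), ∑ i, ∑ j, (fderiv ℝ (fun z => fderiv ℝ
          (fun z' => fderiv ℝ u z' (b m)) z (b i)) y (b j)) ^ 2 ≤ A₃ * r ^ (q - 6)) →
      (∫ y in closedBall x (θ * r / 4), ∑ i, ∑ j,
          (fderiv ℝ (fun z => fderiv ℝ u z (b i)) y (b j)) ^ 2 ≤ A₂ * r ^ (q - 4)) →
      (∫ y in closedBall x (θ * r / 4), ∑ i, (fderiv ℝ u y (b i)) ^ 2 ≤ A₁ * r ^ (q - 2)) →
      (∫ y in closedBall x (θ * r / 4), u y ^ 2 ≤ K₀ * r ^ q) →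
      ∀ m n, (fderiv ℝ (fun z => fderiv ℝ u z (b m)) x (b n)) ^ 2 ≤ A₅ * r ^ (q - 7) := by
  obtain ⟨ε₁, C_W, hε₁, hC_W, hL2⟩ := level_two_six b
  obtain ⟨C_G, hGNS⟩ := eLpNorm_six_le_of_ball b
  set V : ℝ≥0∞ := (volume (ball (0 : E3) 1)) ^ (6 : ℝ)⁻¹ with hV
  have hVtop : V ≠ ⊤ := ENNReal.rpow_ne_top_of_nonneg (by positivity) measure_ball_lt_top.ne
  have hVe : V = ENNReal.ofReal V.toReal := (ENNReal.ofReal_toReal hVtop).symm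
  have hV0 : 0 ≤ V.toReal := ENNReal.toReal_nonneg
  have hCG0 : 0 ≤ (C_G : ℝ) := C_G.2
  have hCGe : (C_G : ℝ≥0∞) = ENNReal.ofReal (C_G : ℝ) := (ENNReal.ofReal_coe_nnreal).symm
  refine ⟨ε₁, hε₁, fun θ M K K₀ A₁ A₂ A₃ hθ hM hK hK₀ hA₁ hA₂ hA₃ ↦ ?_⟩
  -- the constants
  set a₂ : ℝ := Real.sqrt A₃ + 4 * Real.sqrt A₂ / θ with ha₂
  set a₁ : ℝ := Real.sqrt A₂ + 4 * Real.sqrt A₁ / θ with ha₁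
  set a₀ : ℝ := Real.sqrt A₁ + 4 * Real.sqrt K₀ / θ with ha₀
  have ha₂0 : 0 ≤ a₂ := by positivity
  have ha₁0 : 0 ≤ a₁ := by positivity
  have ha₀0 : 0 ≤ a₀ := by positivity
  set B₀ : ℝ := (M + 8) / θ * (3 * (C_G * a₂)) + (M ^ 2 + 64) / θ ^ 2 * (C_G * a₁)
    + V.toReal * K * Real.sqrt (θ / 8) + 3 * K * (9 * (C_G * a₂) + 3 * (C_G * a₁) + C_G * a₀) with hB₀
  have hM0 : 0 ≤ M := by linarith
  have hB₀0 : 0 ≤ B₀ := by positivity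
  set E : ℝ := C_W * Real.sqrt (θ / 8) * B₀ with hE
  have hE0 : 0 ≤ E := by positivity
  refine ⟨E ^ 2, sq_nonneg _, fun U x r q ε u g a β c hU hr hq hε0 hε hxU hu hg has hβs hcs heq ha hβ
    hc hΛ hg1 h3 h2 h1 h0 m n ↦ ?_⟩
  have hr0 : 0 < r := by linarith
  have hθr : 0 < θ * r := mul_pos hθ hr0
  have hσ₁ : 0 < θ * r / 8 := by positivity
  have hσ₄ : 0 < θ * r / 4 := by positivity
  have hsub : closedBall x (θ * r / 8) ⊆ closedBall x (θ * r / 4) :=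
    closedBall_subset_closedBall (by linarith)
  have hxU₁ : closedBall x (θ * r / 8) ⊆ U := hsub.trans hxU
  have hL0 : 0 ≤ M / (θ * r) := by positivity
  have hΛ0 : 0 ≤ 3 * K * r ^ (-3 : ℝ) := by positivity
  set μ : Measure E3 := (volume : Measure E3).restrict (closedBall x (θ * r / 8)) with hμ
  /- ───── the `L⁶` estimate at the centre ───── -/
  have key := hL2 U x (θ * r / 8) u g a β c ε (M / (θ * r)) (3 * K * r ^ (-3 : ℝ)) hU hσ₁ hxU₁ hu hg
    has hβs hcs hε0 hε hL0 hΛ0 heq ha hβ hc hΛ m n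
  rw [← hμ] at key
  /- ───── continuity on the larger ball ───── -/
  have hu1 : ∀ i, ContDiffOn ℝ ∞ (fun y ↦ fderiv ℝ u y (b i)) U := fun i ↦
    contDiffOn_fderiv_apply_of_isOpen hU hu (b i)
  have hu2 : ∀ i j, ContDiffOn ℝ ∞ (fun y ↦ fderiv ℝ (fun z ↦ fderiv ℝ u z (b i)) y (b j)) U :=
    fun i j ↦ contDiffOn_fderiv_apply_of_isOpen hU (hu1 i) (b j)
  have hu3 : ∀ i j k, ContDiffOn ℝ ∞ (fun y ↦ fderiv ℝ (fun z ↦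
      fderiv ℝ (fun z' ↦ fderiv ℝ u z' (b i)) z (b j)) y (b k)) U :=
    fun i j k ↦ contDiffOn_fderiv_apply_of_isOpen hU (hu2 i j) (b k)
  have hKc : IsCompact (closedBall x (θ * r / 4)) := isCompact_closedBall _ _
  have cu0 : ContinuousOn u (closedBall x (θ * r / 4)) := hu.continuousOn.mono hxU
  have cu1 : ∀ i, ContinuousOn (fun y ↦ fderiv ℝ u y (b i)) (closedBall x (θ * r / 4)) := fun i ↦
    (hu1 i).continuousOn.mono hxU
  have cu2 : ∀ i j, ContinuousOn (fun y ↦ fderiv ℝ (fun z ↦ fderiv ℝ u z (b i)) y (b j))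
      (closedBall x (θ * r / 4)) := fun i j ↦ (hu2 i j).continuousOn.mono hxU
  have cu3 : ∀ i j k, ContinuousOn (fun y ↦ fderiv ℝ (fun z ↦
      fderiv ℝ (fun z' ↦ fderiv ℝ u z' (b i)) z (b j)) y (b k)) (closedBall x (θ * r / 4)) :=
    fun i j k ↦ (hu3 i j k).continuousOn.mono hxU
  /- ───── single energies against the given sums ───── -/
  have hrp0 : ∀ s : ℝ, 0 < r ^ s := fun s ↦ Real.rpow_pos_of_pos hr0 s
  have hE3 : ∀ k l, ∫ y in closedBall x (θ * r / 4), ∑ i, (fderiv ℝ (fun z ↦ fderiv ℝ (fun z' ↦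
      fderiv ℝ u z' (b k)) z (b l)) y (b i)) ^ 2 ≤ A₃ * r ^ (q - 6) := by
    intro k l
    refine (setIntegral_le_setIntegral_of_le hKc Subset.rfl
      (continuousOn_finsetSum _ fun i _ ↦ (cu3 k l i).pow 2)
      (continuousOn_finsetSum _ fun i _ ↦ continuousOn_finsetSum _ fun j _ ↦ (cu3 k i j).pow 2)
      (fun y _ ↦ Finset.sum_nonneg fun i _ ↦ sq_nonneg _) (fun y _ ↦ ?_)).trans (h3 k)
    exact Finset.single_le_sum (f := fun i ↦ ∑ j, (fderiv ℝ (fun z ↦ fderiv ℝ (fun z' ↦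
      fderiv ℝ u z' (b k)) z (b i)) y (b j)) ^ 2) (fun i _ ↦ Finset.sum_nonneg fun j _ ↦ sq_nonneg _)
      (Finset.mem_univ l)
  have hE2s : ∀ k l, ∫ y in closedBall x (θ * r / 4),
      (fderiv ℝ (fun z ↦ fderiv ℝ u z (b k)) y (b l)) ^ 2 ≤ A₂ * r ^ (q - 4) := by
    intro k l
    refine (setIntegral_le_setIntegral_of_le hKc Subset.rfl ((cu2 k l).pow 2)
      (continuousOn_finsetSum _ fun i _ ↦ continuousOn_finsetSum _ fun j _ ↦ (cu2 i j).pow 2)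
      (fun y _ ↦ sq_nonneg _) (fun y _ ↦ ?_)).trans h2
    calc (fderiv ℝ (fun z ↦ fderiv ℝ u z (b k)) y (b l)) ^ 2
        ≤ ∑ j, (fderiv ℝ (fun z ↦ fderiv ℝ u z (b k)) y (b j)) ^ 2 :=
          Finset.single_le_sum (f := fun j ↦ (fderiv ℝ (fun z ↦ fderiv ℝ u z (b k)) y (b j)) ^ 2)
            (fun j _ ↦ sq_nonneg _) (Finset.mem_univ l)
      _ ≤ ∑ i, ∑ j, (fderiv ℝ (fun z ↦ fderiv ℝ u z (b i)) y (b j)) ^ 2 :=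
          Finset.single_le_sum (f := fun i ↦ ∑ j, (fderiv ℝ (fun z ↦ fderiv ℝ u z (b i)) y (b j)) ^ 2)
            (fun i _ ↦ Finset.sum_nonneg fun j _ ↦ sq_nonneg _) (Finset.mem_univ k)
  have hE2r : ∀ k, ∫ y in closedBall x (θ * r / 4), ∑ i,
      (fderiv ℝ (fun z ↦ fderiv ℝ u z (b k)) y (b i)) ^ 2 ≤ A₂ * r ^ (q - 4) := by
    intro k
    refine (setIntegral_le_setIntegral_of_le hKc Subset.rfl
      (continuousOn_finsetSum _ fun i _ ↦ (cu2 k i).pow 2)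
      (continuousOn_finsetSum _ fun i _ ↦ continuousOn_finsetSum _ fun j _ ↦ (cu2 i j).pow 2)
      (fun y _ ↦ Finset.sum_nonneg fun i _ ↦ sq_nonneg _) (fun y _ ↦ ?_)).trans h2
    exact Finset.single_le_sum (f := fun i ↦ ∑ j, (fderiv ℝ (fun z ↦ fderiv ℝ u z (b i)) y (b j)) ^ 2)
      (fun i _ ↦ Finset.sum_nonneg fun j _ ↦ sq_nonneg _) (Finset.mem_univ k)
  have hE1s : ∀ k, ∫ y in closedBall x (θ * r / 4), (fderiv ℝ u y (b k)) ^ 2 ≤ A₁ * r ^ (q - 2) := by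
    intro k
    refine (setIntegral_le_setIntegral_of_le hKc Subset.rfl ((cu1 k).pow 2)
      (continuousOn_finsetSum _ fun i _ ↦ (cu1 i).pow 2) (fun y _ ↦ sq_nonneg _) (fun y _ ↦ ?_)).trans h1
    exact Finset.single_le_sum (f := fun i ↦ (fderiv ℝ u y (b i)) ^ 2) (fun i _ ↦ sq_nonneg _)
      (Finset.mem_univ k)
  /- ───── the Sobolev bounds in `L⁶(B̄(x, θr/8))` ───── -/
  have e48 : θ * r / 4 / 2 = θ * r / 8 := by ring
  have hsq : ∀ {A e : ℝ}, 0 ≤ A → Real.sqrt (A * r ^ e) = Real.sqrt A * r ^ (e / 2) := by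
    intro A e hA
    rw [Real.sqrt_mul hA, Real.sqrt_eq_rpow (r ^ e), ← Real.rpow_mul hr0.le]
    congr 1
    ring
  have hpw : ∀ s t : ℝ, r ^ s * r ^ t = r ^ (s + t) := fun s t ↦ (Real.rpow_add hr0 s t).symm
  have hinv4 : (θ * r / 4)⁻¹ = 4 / θ * r ^ (-1 : ℝ) := by
    rw [Real.rpow_neg_one]; field_simp
  -- generic: `N(F) ≤ C_G (√(A r^e) + (θr/4)⁻¹ √(A' r^{e+2})) = C_G (√A + 4√A'/θ) r^{e/2}`
  have hgns : ∀ {F : E3 → ℝ} {A A' e : ℝ}, ContDiffOn ℝ ∞ F U → 0 ≤ A → 0 ≤ A' →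
      (∫ y in closedBall x (θ * r / 4), ∑ i, (fderiv ℝ F y (b i)) ^ 2) ≤ A * r ^ e →
      (∫ y in closedBall x (θ * r / 4), F y ^ 2) ≤ A' * r ^ (e + 2) →
      eLpNorm F 6 μ ≤ ENNReal.ofReal (C_G * ((Real.sqrt A + 4 * Real.sqrt A' / θ) * r ^ (e / 2))) := by
    intro F A A' e hF hA hA' hIF hIF0
    have h := hGNS U F x (θ * r / 4) hU hxU hF hσ₄
    rw [e48, ← hμ] at h
    refine h.trans ?_
    rw [hCGe, ← ENNReal.ofReal_mul hCG0]
    refine ENNReal.ofReal_le_ofReal (mul_le_mul_of_nonneg_left ?_ hCG0)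
    have t1 : Real.sqrt (∫ y in closedBall x (θ * r / 4), ∑ i, (fderiv ℝ F y (b i)) ^ 2) ≤
        Real.sqrt A * r ^ (e / 2) := by
      rw [← hsq hA]; exact Real.sqrt_le_sqrt hIF
    have t2 : (θ * r / 4)⁻¹ * Real.sqrt (∫ y in closedBall x (θ * r / 4), F y ^ 2) ≤
        4 * Real.sqrt A' / θ * r ^ (e / 2) := by
      have h' : Real.sqrt (∫ y in closedBall x (θ * r / 4), F y ^ 2) ≤ Real.sqrt A' * r ^ ((e + 2) / 2) := by
        rw [← hsq hA']; exact Real.sqrt_le_sqrt hIF0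
      calc (θ * r / 4)⁻¹ * Real.sqrt (∫ y in closedBall x (θ * r / 4), F y ^ 2)
          ≤ (θ * r / 4)⁻¹ * (Real.sqrt A' * r ^ ((e + 2) / 2)) :=
            mul_le_mul_of_nonneg_left h' (by positivity)
        _ = 4 * Real.sqrt A' / θ * (r ^ (-1 : ℝ) * r ^ ((e + 2) / 2)) := by rw [hinv4]; ring
        _ = 4 * Real.sqrt A' / θ * r ^ (e / 2) := by rw [hpw]; ring_nf
    calc Real.sqrt (∫ y in closedBall x (θ * r / 4), ∑ i, (fderiv ℝ F y (b i)) ^ 2)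
          + (θ * r / 4)⁻¹ * Real.sqrt (∫ y in closedBall x (θ * r / 4), F y ^ 2)
        ≤ Real.sqrt A * r ^ (e / 2) + 4 * Real.sqrt A' / θ * r ^ (e / 2) := add_le_add t1 t2
      _ = (Real.sqrt A + 4 * Real.sqrt A' / θ) * r ^ (e / 2) := by ring
  have n22 : ∀ k l, eLpNorm (fun y ↦ fderiv ℝ (fun z ↦ fderiv ℝ u z (b k)) y (b l)) 6 μ ≤
      ENNReal.ofReal (C_G * (a₂ * r ^ ((q - 6) / 2))) := fun k l ↦
    hgns (hu2 k l) hA₃ hA₂ (hE3 k l) (by rw [show q - 6 + 2 = q - 4 by ring]; exact hE2s k l)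
  have n1 : ∀ k, eLpNorm (fun y ↦ fderiv ℝ u y (b k)) 6 μ ≤
      ENNReal.ofReal (C_G * (a₁ * r ^ ((q - 4) / 2))) := fun k ↦
    hgns (hu1 k) hA₂ hA₁ (hE2r k) (by rw [show q - 4 + 2 = q - 2 by ring]; exact hE1s k)
  have n0 : eLpNorm u 6 μ ≤ ENNReal.ofReal (C_G * (a₀ * r ^ ((q - 2) / 2))) :=
    hgns hu hA₁ hK₀ h1 (by rw [show q - 2 + 2 = q by ring]; exact h0)
  have ng : eLpNorm (fun y ↦ fderiv ℝ g y (b m)) 6 μ ≤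
      ENNReal.ofReal (V.toReal * (K * r ^ (-5 : ℝ) * Real.sqrt (θ * r / 8))) := by
    have h := eLpNorm_six_restrict_le_of_bound (x := x) hσ₁.le (by positivity : (0:ℝ) ≤ K * r ^ (-5 : ℝ))
      (hg1 m)
    rw [← hμ, ← hV] at h
    refine h.trans (le_of_eq ?_)
    rw [hVe, ← ENNReal.ofReal_mul hV0, ENNReal.toReal_ofReal hV0]
  /- ───── everything under one `ofReal` ───── -/
  set c₂ : ℝ := C_G * (a₂ * r ^ ((q - 6) / 2)) with hc₂
  set c₁ : ℝ := C_G * (a₁ * r ^ ((q - 4) / 2)) with hc₁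
  set c₀ : ℝ := C_G * (a₀ * r ^ ((q - 2) / 2)) with hc₀
  set cg : ℝ := V.toReal * (K * r ^ (-5 : ℝ) * Real.sqrt (θ * r / 8)) with hcg
  have hc₂0 : 0 ≤ c₂ := by positivity
  have hc₁0 : 0 ≤ c₁ := by positivity
  have hc₀0 : 0 ≤ c₀ := by positivity
  have hcg0 : 0 ≤ cg := by positivity
  set L : ℝ := M / (θ * r) with hL
  set Λ₁ : ℝ := 3 * K * r ^ (-3 : ℝ) with hΛ₁
  have hco10 : 0 ≤ L + (θ * r / 8)⁻¹ := by positivity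
  have hco20 : 0 ≤ L ^ 2 + (θ * r / 8)⁻¹ ^ 2 := by positivity
  set T : ℝ := (L + (θ * r / 8)⁻¹) * (3 * c₂) + (L ^ 2 + (θ * r / 8)⁻¹ ^ 2) * c₁
    + (cg + Λ₁ * (9 * c₂ + 3 * c₁ + c₀)) with hT
  have hT0 : 0 ≤ T := by positivity
  have hsum3 : ∀ {c : ℝ}, 0 ≤ c → ∑ _l : Fin 3, ENNReal.ofReal c = ENNReal.ofReal (3 * c) := by
    intro c hc
    rw [Finset.sum_const, Finset.card_univ, Fintype.card_fin, nsmul_eq_mul, Nat.cast_ofNat,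
      ENNReal.ofReal_mul (by norm_num), ENNReal.ofReal_ofNat]
  have s1 : ∑ l, eLpNorm (fun y ↦ fderiv ℝ (fun z ↦ fderiv ℝ u z (b m)) y (b l)) 6 μ ≤
      ENNReal.ofReal (3 * c₂) := by
    rw [← hsum3 hc₂0]; exact Finset.sum_le_sum fun l _ ↦ n22 m l
  have s2 : ∑ k, ∑ l, eLpNorm (fun y ↦ fderiv ℝ (fun z ↦ fderiv ℝ u z (b k)) y (b l)) 6 μ ≤
      ENNReal.ofReal (9 * c₂) := by
    calc ∑ k, ∑ l, eLpNorm (fun y ↦ fderiv ℝ (fun z ↦ fderiv ℝ u z (b k)) y (b l)) 6 μ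
        ≤ ∑ _k : Fin 3, ENNReal.ofReal (3 * c₂) :=
          Finset.sum_le_sum fun k _ ↦ by rw [← hsum3 hc₂0]; exact Finset.sum_le_sum fun l _ ↦ n22 k l
      _ = ENNReal.ofReal (9 * c₂) := by rw [hsum3 (by positivity)]; ring_nf
  have s3 : ∑ k, eLpNorm (fun y ↦ fderiv ℝ u y (b k)) 6 μ ≤ ENNReal.ofReal (3 * c₁) := by
    rw [← hsum3 hc₁0]; exact Finset.sum_le_sum fun k _ ↦ n1 k
  set t₁ : ℝ := (L + (θ * r / 8)⁻¹) * (3 * c₂) with ht₁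
  set t₂ : ℝ := (L ^ 2 + (θ * r / 8)⁻¹ ^ 2) * c₁ with ht₂
  set t₄ : ℝ := Λ₁ * (9 * c₂ + 3 * c₁ + c₀) with ht₄
  have ht₁0 : 0 ≤ t₁ := by positivity
  have ht₂0 : 0 ≤ t₂ := by positivity
  have ht₄0 : 0 ≤ t₄ := by positivity
  have hTe : ENNReal.ofReal T =
      ENNReal.ofReal (L + (θ * r / 8)⁻¹) * ENNReal.ofReal (3 * c₂)
        + ENNReal.ofReal (L ^ 2 + (θ * r / 8)⁻¹ ^ 2) * ENNReal.ofReal c₁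
        + (ENNReal.ofReal cg + ENNReal.ofReal Λ₁ *
          (ENNReal.ofReal (9 * c₂) + ENNReal.ofReal (3 * c₁) + ENNReal.ofReal c₀)) := by
    have h9 : (0 : ℝ) ≤ 9 * c₂ := by positivity
    have h3 : (0 : ℝ) ≤ 3 * c₁ := by positivity
    have h3' : (0 : ℝ) ≤ 3 * c₂ := by positivity
    rw [hT, ENNReal.ofReal_add (add_nonneg ht₁0 ht₂0) (add_nonneg hcg0 ht₄0),
      ENNReal.ofReal_add ht₁0 ht₂0, ENNReal.ofReal_add hcg0 ht₄0, ht₁, ENNReal.ofReal_mul hco10,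
      ht₂, ENNReal.ofReal_mul hco20, ht₄, ENNReal.ofReal_mul hΛ0,
      ENNReal.ofReal_add (add_nonneg h9 h3) hc₀0, ENNReal.ofReal_add h9 h3]
  have hRHS : ENNReal.ofReal (C_W * Real.sqrt (θ * r / 8)) *
      (ENNReal.ofReal (L + (θ * r / 8)⁻¹) *
          ∑ l, eLpNorm (fun y ↦ fderiv ℝ (fun z ↦ fderiv ℝ u z (b m)) y (b l)) 6 μ
        + ENNReal.ofReal (L ^ 2 + (θ * r / 8)⁻¹ ^ 2) * eLpNorm (fun y ↦ fderiv ℝ u y (b m)) 6 μ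
        + (eLpNorm (fun y ↦ fderiv ℝ g y (b m)) 6 μ + ENNReal.ofReal Λ₁ *
          (∑ k, ∑ l, eLpNorm (fun y ↦ fderiv ℝ (fun z ↦ fderiv ℝ u z (b k)) y (b l)) 6 μ
            + ∑ k, eLpNorm (fun y ↦ fderiv ℝ u y (b k)) 6 μ + eLpNorm u 6 μ))) ≤
      ENNReal.ofReal (C_W * Real.sqrt (θ * r / 8)) * ENNReal.ofReal T := by
    refine mul_le_mul' le_rfl ?_
    rw [hTe]
    exact add_le_add (add_le_add (mul_le_mul' le_rfl s1) (mul_le_mul' le_rfl (n1 m)))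
      (add_le_add ng (mul_le_mul' le_rfl (add_le_add (add_le_add s2 s3) n0)))
  /- ───── the powers of `r` ───── -/
  have hmo : ∀ {s t : ℝ}, s ≤ t → r ^ s ≤ r ^ t := fun hst ↦
    Real.rpow_le_rpow_of_exponent_le hr hst
  have hco1 : L + (θ * r / 8)⁻¹ = (M + 8) / θ * r ^ (-1 : ℝ) := by
    rw [hL, Real.rpow_neg_one]; field_simp
  have hr2 : r ^ (-2 : ℝ) = (r ^ 2)⁻¹ := by
    rw [Real.rpow_neg hr0.le, show (2 : ℝ) = ((2 : ℕ) : ℝ) by norm_num, Real.rpow_natCast]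
  have hco2 : L ^ 2 + (θ * r / 8)⁻¹ ^ 2 = (M ^ 2 + 64) / θ ^ 2 * r ^ (-2 : ℝ) := by
    rw [hL, hr2]; field_simp; ring
  have hsqrt : Real.sqrt (θ * r / 8) = Real.sqrt (θ / 8) * r ^ (1 / 2 : ℝ) := by
    rw [show θ * r / 8 = θ / 8 * r by ring, Real.sqrt_mul (by positivity), Real.sqrt_eq_rpow r]
  set P : ℝ := r ^ ((q - 8) / 2) with hP
  have hP0 : 0 ≤ P := (hrp0 _).le
  have t1 : (L + (θ * r / 8)⁻¹) * (3 * c₂) = (M + 8) / θ * (3 * (C_G * a₂)) * P := by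
    rw [hco1, hc₂, hP]
    calc (M + 8) / θ * r ^ (-1 : ℝ) * (3 * (C_G * (a₂ * r ^ ((q - 6) / 2))))
        = (M + 8) / θ * (3 * (C_G * a₂)) * (r ^ (-1 : ℝ) * r ^ ((q - 6) / 2)) := by ring
      _ = (M + 8) / θ * (3 * (C_G * a₂)) * r ^ ((q - 8) / 2) := by rw [hpw]; ring_nf
  have t2 : (L ^ 2 + (θ * r / 8)⁻¹ ^ 2) * c₁ = (M ^ 2 + 64) / θ ^ 2 * (C_G * a₁) * P := by
    rw [hco2, hc₁, hP]
    calc (M ^ 2 + 64) / θ ^ 2 * r ^ (-2 : ℝ) * (C_G * (a₁ * r ^ ((q - 4) / 2)))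
        = (M ^ 2 + 64) / θ ^ 2 * (C_G * a₁) * (r ^ (-2 : ℝ) * r ^ ((q - 4) / 2)) := by ring
      _ = (M ^ 2 + 64) / θ ^ 2 * (C_G * a₁) * r ^ ((q - 8) / 2) := by rw [hpw]; ring_nf
  have t3 : cg ≤ V.toReal * K * Real.sqrt (θ / 8) * P := by
    rw [hcg, hsqrt, hP]
    calc V.toReal * (K * r ^ (-5 : ℝ) * (Real.sqrt (θ / 8) * r ^ (1 / 2 : ℝ)))
        = V.toReal * K * Real.sqrt (θ / 8) * (r ^ (-5 : ℝ) * r ^ (1 / 2 : ℝ)) := by ring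
      _ = V.toReal * K * Real.sqrt (θ / 8) * r ^ (-9 / 2 : ℝ) := by rw [hpw]; norm_num
      _ ≤ V.toReal * K * Real.sqrt (θ / 8) * r ^ ((q - 8) / 2) :=
          mul_le_mul_of_nonneg_left (hmo (by linarith)) (by positivity)
  have t4 : Λ₁ * (9 * c₂ + 3 * c₁ + c₀) ≤ 3 * K * (9 * (C_G * a₂) + 3 * (C_G * a₁) + C_G * a₀) * P := by
    rw [hΛ₁, hc₂, hc₁, hc₀, hP]
    have e1 : r ^ (-3 : ℝ) * r ^ ((q - 6) / 2) ≤ r ^ ((q - 8) / 2) := by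
      rw [hpw]; exact hmo (by linarith)
    have e2 : r ^ (-3 : ℝ) * r ^ ((q - 4) / 2) ≤ r ^ ((q - 8) / 2) := by
      rw [hpw]; exact hmo (by linarith)
    have e3 : r ^ (-3 : ℝ) * r ^ ((q - 2) / 2) ≤ r ^ ((q - 8) / 2) := by
      rw [hpw]; exact le_of_eq (by ring_nf)
    have k1 := mul_le_mul_of_nonneg_left e1 (by positivity : (0:ℝ) ≤ 3 * K * (9 * (C_G * a₂)))
    have k2 := mul_le_mul_of_nonneg_left e2 (by positivity : (0:ℝ) ≤ 3 * K * (3 * (C_G * a₁)))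
    have k3 := mul_le_mul_of_nonneg_left e3 (by positivity : (0:ℝ) ≤ 3 * K * (C_G * a₀))
    calc 3 * K * r ^ (-3 : ℝ) * (9 * (C_G * (a₂ * r ^ ((q - 6) / 2))) + 3 * (C_G * (a₁ * r ^ ((q - 4) / 2)))
          + C_G * (a₀ * r ^ ((q - 2) / 2)))
        = 3 * K * (9 * (C_G * a₂)) * (r ^ (-3 : ℝ) * r ^ ((q - 6) / 2))
          + 3 * K * (3 * (C_G * a₁)) * (r ^ (-3 : ℝ) * r ^ ((q - 4) / 2))
          + 3 * K * (C_G * a₀) * (r ^ (-3 : ℝ) * r ^ ((q - 2) / 2)) := by ring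
      _ ≤ 3 * K * (9 * (C_G * a₂)) * r ^ ((q - 8) / 2) + 3 * K * (3 * (C_G * a₁)) * r ^ ((q - 8) / 2)
          + 3 * K * (C_G * a₀) * r ^ ((q - 8) / 2) := add_le_add (add_le_add k1 k2) k3
      _ = 3 * K * (9 * (C_G * a₂) + 3 * (C_G * a₁) + C_G * a₀) * r ^ ((q - 8) / 2) := by ring
  have hTB : T ≤ B₀ * P := by
    rw [hT, ht₁, ht₂, ht₄, t1, t2, hB₀]
    nlinarith [t3, t4, hP0]
  have hfinal : C_W * Real.sqrt (θ * r / 8) * T ≤ E * r ^ ((q - 7) / 2) := by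
    have e : r ^ (1 / 2 : ℝ) * P = r ^ ((q - 7) / 2) := by rw [hP, hpw]; ring_nf
    calc C_W * Real.sqrt (θ * r / 8) * T ≤ C_W * Real.sqrt (θ * r / 8) * (B₀ * P) :=
          mul_le_mul_of_nonneg_left hTB (by positivity)
      _ = C_W * Real.sqrt (θ / 8) * B₀ * (r ^ (1 / 2 : ℝ) * P) := by rw [hsqrt]; ring
      _ = E * r ^ ((q - 7) / 2) := by rw [e, hE]
  /- ───── conclusion ───── -/
  have hz : ‖fderiv ℝ (fun z ↦ fderiv ℝ u z (b m)) x (b n)‖ₑ ≤ ENNReal.ofReal (E * r ^ ((q - 7) / 2)) := by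
    refine (key.trans hRHS).trans ?_
    rw [← ENNReal.ofReal_mul (by positivity)]
    exact ENNReal.ofReal_le_ofReal hfinal
  have habs : |fderiv ℝ (fun z ↦ fderiv ℝ u z (b m)) x (b n)| ≤ E * r ^ ((q - 7) / 2) := by
    rw [← Real.norm_eq_abs, ← ENNReal.ofReal_le_ofReal_iff (by positivity), ofReal_norm]
    exact hz
  have hsq2 : (E * r ^ ((q - 7) / 2)) ^ 2 = E ^ 2 * r ^ (q - 7) := by
    rw [mul_pow, ← Real.rpow_natCast (r ^ ((q - 7) / 2)) 2, ← Real.rpow_mul hr0.le]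
    norm_num
  calc (fderiv ℝ (fun z ↦ fderiv ℝ u z (b m)) x (b n)) ^ 2
      = |fderiv ℝ (fun z ↦ fderiv ℝ u z (b m)) x (b n)| ^ 2 := (sq_abs _).symm
    _ ≤ (E * r ^ ((q - 7) / 2)) ^ 2 := pow_le_pow_left₀ (abs_nonneg _) habs 2
    _ = E ^ 2 * r ^ (q - 7) := hsq2

end LevelTwoDecay

/-! ### The decay bootstrap with one derivative of the source -/

section Bootstrap

set_option maxHeartbeats 1600000 in
/-- **Decay bootstrap on an exterior region of `ℝ³`, with one derivative of the source.** Let `u`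
be a classical (smooth) solution of `Σ aₖₗ ∂ₗ∂ₖu + Σ βₖ ∂ₖu + c u = g` on `{‖y‖ > R₀}` whose
coefficients approach those of the Laplacian with the rates of an asymptotically flat metric
(`Σ|aₖₗ − δₖₗ| ≤ K r⁻²`, `Σ|βₖ| ≤ K r⁻³`, `|c| ≤ K r⁻⁴`, first partial derivatives of the
coefficients `≤ K r⁻³`), with right-hand side controlled on the balls `B̄(x, θ‖x‖)` by
`∫ g² ≤ K ‖x‖⁻⁵`, `∫ (∂g)² ≤ K ‖x‖⁻⁷` and `|∂g| ≤ K ‖x‖⁻⁵` pointwise, and suppose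
`∫_{B̄(x,θ‖x‖)} u² ≤ K₀ ‖x‖^q` for large `‖x‖` (`q ≥ −1`, `0 < θ ≤ 1/4`). Then for large `‖x‖`:
`u(x)² ≲ ‖x‖^{q−3}`, `(∂ₘu(x))² ≲ ‖x‖^{q−5}`, `(∂ₙ∂ₘu(x))² ≲ ‖x‖^{q−7}`. Levels zero and one are
those of `decay_bootstrap` (`DecayBootstrap.lean`, verbatim); level two is `level_two_six_decay`
(Calderón–Zygmund in `L⁶` and Morrey in place of the `H⁴ ⊂ C²` step, which would need `∂²g`).
This is the mechanism of Schoen–Yau's (3.9) and (3.19)–(3.20) for the family `ds² + t Ric`,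
whose scalar curvature has one controlled derivative.
[cite: SchoenYauPMT1979, proof of Lemma 3.2, (3.9) and (3.19)–(3.20)] -/
theorem decay_bootstrap_six (b : OrthonormalBasis (Fin 3) ℝ E3)
    {R₀ θ K K₀ q r₁ : ℝ} (hθ : 0 < θ) (hθ4 : θ ≤ 1 / 4) (hq : -1 ≤ q) (hK : 0 ≤ K) (hK₀ : 0 ≤ K₀)
    {u g : E3 → ℝ} {a : Fin 3 → Fin 3 → E3 → ℝ} {β : Fin 3 → E3 → ℝ} {c : E3 → ℝ}
    (hu : ContDiffOn ℝ ∞ u {y : E3 | R₀ < ‖y‖}) (hg : ContDiffOn ℝ ∞ g {y : E3 | R₀ < ‖y‖})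
    (has : ∀ k l, ContDiffOn ℝ ∞ (a k l) {y : E3 | R₀ < ‖y‖})
    (hβs : ∀ k, ContDiffOn ℝ ∞ (β k) {y : E3 | R₀ < ‖y‖}) (hcs : ContDiffOn ℝ ∞ c {y : E3 | R₀ < ‖y‖})
    (heq : ∀ z ∈ {y : E3 | R₀ < ‖y‖},
      ∑ k, ∑ l, a k l z * fderiv ℝ (fun z' => fderiv ℝ u z' (b k)) z (b l)
        + ∑ k, β k z * fderiv ℝ u z (b k) + c z * u z = g z)
    (hcoef : ∀ y : E3, r₁ ≤ ‖y‖ →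
      (∑ k, ∑ l, |a k l y - if k = l then 1 else 0| ≤ K * ‖y‖ ^ (-2 : ℝ)) ∧
      (∑ k, |β k y| ≤ K * ‖y‖ ^ (-3 : ℝ)) ∧ |c y| ≤ K * ‖y‖ ^ (-4 : ℝ) ∧
      (∀ i, (∀ k l, |fderiv ℝ (a k l) y (b i)| ≤ K * ‖y‖ ^ (-3 : ℝ)) ∧
        (∀ k, |fderiv ℝ (β k) y (b i)| ≤ K * ‖y‖ ^ (-3 : ℝ)) ∧
        |fderiv ℝ c y (b i)| ≤ K * ‖y‖ ^ (-3 : ℝ)))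
    (hG : ∀ x : E3, r₁ ≤ ‖x‖ →
      (∫ y in closedBall x (θ * ‖x‖), g y ^ 2) ≤ K * ‖x‖ ^ (-5 : ℝ) ∧
      (∀ m, (∫ y in closedBall x (θ * ‖x‖), (fderiv ℝ g y (b m)) ^ 2) ≤ K * ‖x‖ ^ (-7 : ℝ)) ∧
      (∀ m, ∀ y ∈ closedBall x (θ * ‖x‖), |fderiv ℝ g y (b m)| ≤ K * ‖x‖ ^ (-5 : ℝ)))
    (hI : ∀ x : E3, r₁ ≤ ‖x‖ → (∫ y in closedBall x (θ * ‖x‖), u y ^ 2) ≤ K₀ * ‖x‖ ^ q) :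
    ∃ C r₂ : ℝ, ∀ x : E3, r₂ ≤ ‖x‖ →
      u x ^ 2 ≤ C * ‖x‖ ^ (q - 3) ∧
      (∀ m, (fderiv ℝ u x (b m)) ^ 2 ≤ C * ‖x‖ ^ (q - 5)) ∧
      (∀ m n, (fderiv ℝ (fun z => fderiv ℝ u z (b m)) x (b n)) ^ 2 ≤ C * ‖x‖ ^ (q - 7)) := by
  obtain ⟨M, C₀, hM1, hC1, hMC⟩ := ball_estimates_three_weak b
  obtain ⟨ε₁, hε₁, hlev2c⟩ := level_two_six_decay b
  -- the constants
  set A₁ : ℝ := C₀ * ((M / θ) ^ 2 * K₀ + K * (θ / M) ^ 2) with hA₁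
  set A₂ : ℝ := C₀ * ((M / θ) ^ 4 * K₀ + K) with hA₂
  set B₁ : ℝ := 2 * K + 486 * K ^ 2 * (A₂ + A₁ + K₀) with hB₁
  set A₃ : ℝ := C₀ * (16 * (M / θ) ^ 4 * A₁ + B₁) with hA₃
  set A₄ : ℝ := C₀ * (4 * (M / θ) ^ 2 * A₁ + B₁ * (θ / M) ^ 2 / 4) with hA₄
  have hA₁0 : 0 ≤ A₁ := by positivity
  have hA₂0 : 0 ≤ A₂ := by positivity
  have hB₁0 : 0 ≤ B₁ := by positivity
  have hA₃0 : 0 ≤ A₃ := by positivity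
  have hA₄0 : 0 ≤ A₄ := by positivity
  have hM : 0 < M := by linarith
  have hC0 : 0 ≤ C₀ := by linarith
  obtain ⟨A₅, hA₅0, hA₅⟩ := hlev2c θ M K K₀ A₁ A₂ A₃ hθ hM1 hK hK₀ hA₁0 hA₂0 hA₃0
  have hKε : 0 ≤ 2 * K / ε₁ := by positivity
  refine ⟨A₂ + A₃ + A₅, 4 * |R₀| + 4 * |r₁| + 21 * K + 8 + 2 * K / ε₁, fun x hx => ?_⟩
  /- ───── the radius, the ball, the region ───── -/
  obtain ⟨r, hr⟩ : ∃ r : ℝ, r = ‖x‖ := ⟨_, rfl⟩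
  rw [← hr] at hx ⊢
  have hR₀a := abs_nonneg R₀
  have hr₁a := abs_nonneg r₁
  have hr8 : 8 ≤ r := by linarith only [hx, hR₀a, hr₁a, hK, hKε]
  have hr1 : 1 ≤ r := by linarith only [hr8]
  have hr0 : 0 < r := by linarith only [hr8]
  have hxr₁ : r₁ ≤ ‖x‖ := by rw [← hr]; linarith only [hx, le_abs_self r₁, hR₀a, hr₁a, hK, hKε]
  have hrK : 21 * K + 8 ≤ r := by linarith only [hx, hR₀a, hr₁a, hKε]
  have hrε : 2 * K / ε₁ ≤ r := by linarith only [hx, hR₀a, hr₁a, hK]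
  obtain ⟨σ, hσdef⟩ : ∃ σ : ℝ, σ = θ * r := ⟨_, rfl⟩
  have hσ : 0 < σ := by rw [hσdef]; exact mul_pos hθ hr0
  set U : Set E3 := {y : E3 | R₀ < ‖y‖} with hUdef
  have hU : IsOpen U := isOpen_lt continuous_const continuous_norm
  have hyball : ∀ y ∈ closedBall x σ, 3 / 4 * r ≤ ‖y‖ := fun y hy => by
    rw [hσdef, hr] at hy; rw [hr]; exact norm_ge_of_mem_closedBall hθ4 hy
  have hxU : closedBall x σ ⊆ U := fun y hy => by
    show R₀ < ‖y‖
    linarith only [hyball y hy, le_abs_self R₀, hx, hR₀a, hr₁a, hK, hKε]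
  have hyr₁ : ∀ y ∈ closedBall x σ, r₁ ≤ ‖y‖ := fun y hy => by
    linarith only [hyball y hy, le_abs_self r₁, hx, hR₀a, hr₁a, hK, hKε]
  have hypow : ∀ y ∈ closedBall x σ, ∀ p : ℝ, 0 ≤ p → ‖y‖ ^ (-p) ≤ (4 / 3) ^ p * r ^ (-p) := by
    intro y hy p hp
    rw [hσdef, hr] at hy; rw [hr]
    exact rpow_neg_le_of_mem_closedBall hθ4 (by rw [← hr]; exact hr0) hp hy
  -- powers of `r`
  have hpw : ∀ s t : ℝ, r ^ s * r ^ t = r ^ (s + t) := fun s t => (Real.rpow_add hr0 s t).symm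
  have hmo : ∀ {s t : ℝ}, s ≤ t → r ^ s ≤ r ^ t := fun hst =>
    Real.rpow_le_rpow_of_exponent_le hr1 hst
  have hrp0 : ∀ s : ℝ, 0 < r ^ s := fun s => Real.rpow_pos_of_pos hr0 s
  have hrm1 : r ^ (-1 : ℝ) = r⁻¹ := Real.rpow_neg_one r
  /- ───── the coefficient bounds on the ball ───── -/
  obtain ⟨ε, hεdef⟩ : ∃ ε : ℝ, ε = 2 * K * r ^ (-2 : ℝ) := ⟨_, rfl⟩
  have hε0 : 0 ≤ ε := by rw [hεdef]; positivity
  have hKr : K * r⁻¹ ≤ 1 / 21 := by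
    rw [mul_inv_le_iff₀ hr0]; linarith only [hrK]
  have hε : ε ≤ 1 / 10 := by
    have h1 : r ^ (-2 : ℝ) ≤ r ^ (-1 : ℝ) := hmo (by norm_num)
    have h2 := mul_le_mul_of_nonneg_left h1 (by positivity : (0 : ℝ) ≤ 2 * K)
    rw [hrm1] at h2
    rw [hεdef]
    linarith only [h2, hKr]
  obtain ⟨Λ₁, hΛ₁def⟩ : ∃ Λ₁ : ℝ, Λ₁ = 3 * K * r ^ (-3 : ℝ) := ⟨_, rfl⟩
  obtain ⟨Λ₂, hΛ₂def⟩ : ∃ Λ₂ : ℝ, Λ₂ = 4 * K * r ^ (-4 : ℝ) := ⟨_, rfl⟩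
  have hΛ₁0 : 0 ≤ Λ₁ := by rw [hΛ₁def]; positivity
  have hΛ₂0 : 0 ≤ Λ₂ := by rw [hΛ₂def]; positivity
  have h43_2 : (4 / 3 : ℝ) ^ (2 : ℝ) ≤ 2 := by norm_num
  have h43_3 : (4 / 3 : ℝ) ^ (3 : ℝ) ≤ 3 := by norm_num
  have h43_4 : (4 / 3 : ℝ) ^ (4 : ℝ) ≤ 4 := by norm_num
  have hKy : ∀ y ∈ closedBall x σ, ∀ {p c : ℝ}, 0 ≤ p → (4 / 3 : ℝ) ^ p ≤ c →
      K * ‖y‖ ^ (-p) ≤ c * K * r ^ (-p) := by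
    intro y hy p c hp hc
    have h := hypow y hy p hp
    calc K * ‖y‖ ^ (-p) ≤ K * ((4 / 3) ^ p * r ^ (-p)) := mul_le_mul_of_nonneg_left h hK
      _ ≤ K * (c * r ^ (-p)) := by
          refine mul_le_mul_of_nonneg_left ?_ hK
          exact mul_le_mul_of_nonneg_right hc (hrp0 _).le
      _ = c * K * r ^ (-p) := by ring
  have ha' : ∀ y ∈ closedBall x σ, ∑ k, ∑ l, |a k l y - if k = l then 1 else 0| ≤ ε := by
    intro y hy
    have h1 := (hcoef y (hyr₁ y hy)).1
    have h2 := hKy y hy (p := 2) (by norm_num) h43_2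
    rw [hεdef]
    linarith only [h1, h2]
  have hΛ₁ball : ∀ y ∈ closedBall x σ, K * ‖y‖ ^ (-3 : ℝ) ≤ Λ₁ := fun y hy => by
    have := hKy y hy (p := 3) (by norm_num) h43_3
    rw [hΛ₁def]; linarith only [this]
  have hΛ₂ball : ∀ y ∈ closedBall x σ, K * ‖y‖ ^ (-4 : ℝ) ≤ Λ₂ := fun y hy => by
    have := hKy y hy (p := 4) (by norm_num) h43_4
    rw [hΛ₂def]; linarith only [this]
  -- `Λ₁ ≤ M/σ`, `Λ₂ ≤ (M/σ)²`
  have hMθ : (1 : ℝ) ≤ M / θ := by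
    rw [le_div_iff₀ hθ]; nlinarith only [hM1, hθ4, hθ]
  have hL : M / σ = M / θ * r ^ (-1 : ℝ) := by
    rw [hrm1, hσdef]; field_simp
  have hΛ₁L : Λ₁ ≤ M / σ := by
    rw [hL, hΛ₁def]
    have h1 : r ^ (-3 : ℝ) = r ^ (-2 : ℝ) * r ^ (-1 : ℝ) := by rw [hpw]; norm_num
    have h3 : r ^ (-2 : ℝ) ≤ r ^ (-1 : ℝ) := hmo (by norm_num)
    have h4 : 3 * K * r ^ (-2 : ℝ) ≤ 1 := by
      have := mul_le_mul_of_nonneg_left h3 (by positivity : (0 : ℝ) ≤ 3 * K)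
      rw [hrm1] at this
      linarith only [this, hKr]
    rw [h1, ← mul_assoc]
    exact mul_le_mul_of_nonneg_right (h4.trans hMθ) (hrp0 _).le
  have hΛ₂L : Λ₂ ≤ (M / σ) ^ 2 := by
    rw [hL, hΛ₂def, mul_pow]
    have h1 : r ^ (-4 : ℝ) = r ^ (-2 : ℝ) * (r ^ (-1 : ℝ)) ^ 2 := by
      rw [sq, hpw, hpw]; norm_num
    have h3 : r ^ (-2 : ℝ) ≤ r ^ (-1 : ℝ) := hmo (by norm_num)
    have h4 : 4 * K * r ^ (-2 : ℝ) ≤ 1 := by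
      have := mul_le_mul_of_nonneg_left h3 (by positivity : (0 : ℝ) ≤ 4 * K)
      rw [hrm1] at this
      linarith only [this, hKr]
    have h6 : (1 : ℝ) ≤ (M / θ) ^ 2 := by nlinarith only [hMθ]
    rw [h1, ← mul_assoc]
    exact mul_le_mul_of_nonneg_right (h4.trans h6) (sq_nonneg _)
  -- monotone quantities on smaller balls
  have hMσ_mono : ∀ {ρ : ℝ}, 0 < ρ → ρ ≤ σ → M / σ ≤ M / ρ := fun hρ hρσ =>
    div_le_div_of_nonneg_left hM.le hρ hρσ
  have hβ_ball : ∀ y ∈ closedBall x σ, ∑ k, |β k y| ≤ Λ₁ := fun y hy =>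
    ((hcoef y (hyr₁ y hy)).2.1).trans (hΛ₁ball y hy)
  have hc_ball : ∀ y ∈ closedBall x σ, |c y| ≤ Λ₂ := fun y hy =>
    ((hcoef y (hyr₁ y hy)).2.2.1).trans (hΛ₂ball y hy)
  have hΛ₁' : ∀ y ∈ closedBall x σ, ∀ i, (∀ k l, |fderiv ℝ (a k l) y (b i)| ≤ Λ₁) ∧
      (∀ k, |fderiv ℝ (β k) y (b i)| ≤ Λ₁) ∧ |fderiv ℝ c y (b i)| ≤ Λ₁ := by
    intro y hy i
    obtain ⟨h1, h2, h3⟩ := (hcoef y (hyr₁ y hy)).2.2.2 i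
    have hb := hΛ₁ball y hy
    exact ⟨fun k l => (h1 k l).trans hb, fun k => (h2 k).trans hb, h3.trans hb⟩
  /- ───── continuity of `u`, `g` and their partial derivatives on `U` ───── -/
  have hu6 : ContDiffOn ℝ 6 u U := hu.of_le (WithTop.coe_le_coe.mpr le_top)
  have hg6 : ContDiffOn ℝ 6 g U := hg.of_le (WithTop.coe_le_coe.mpr le_top)
  have hu1 : ∀ i, ContDiffOn ℝ 5 (fun y => fderiv ℝ u y (b i)) U := fun i =>
    contDiffOn_fderiv_apply_const hU (n := 5) (by exact_mod_cast hu6) (b i)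
  have hu2 : ∀ i j, ContDiffOn ℝ 4 (fun y => fderiv ℝ (fun z => fderiv ℝ u z (b i)) y (b j)) U :=
    fun i j => contDiffOn_fderiv_apply_const hU (n := 4) (by exact_mod_cast hu1 i) (b j)
  have hu3 : ∀ i j k, ContDiffOn ℝ 3 (fun y => fderiv ℝ (fun z =>
      fderiv ℝ (fun z' => fderiv ℝ u z' (b i)) z (b j)) y (b k)) U :=
    fun i j k => contDiffOn_fderiv_apply_const hU (n := 3) (by exact_mod_cast hu2 i j) (b k)
  have hg1 : ∀ m, ContDiffOn ℝ 5 (fun y => fderiv ℝ g y (b m)) U := fun m =>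
    contDiffOn_fderiv_apply_const hU (n := 5) (by exact_mod_cast hg6) (b m)
  have cu0 : ContinuousOn u (closedBall x σ) := hu.continuousOn.mono hxU
  have cu1 : ∀ i, ContinuousOn (fun y => fderiv ℝ u y (b i)) (closedBall x σ) := fun i =>
    (hu1 i).continuousOn.mono hxU
  have cu2 : ∀ i j, ContinuousOn (fun y => fderiv ℝ (fun z => fderiv ℝ u z (b i)) y (b j))
      (closedBall x σ) := fun i j => (hu2 i j).continuousOn.mono hxU
  have cu3 : ∀ i j k, ContinuousOn (fun y => fderiv ℝ (fun z =>
      fderiv ℝ (fun z' => fderiv ℝ u z' (b i)) z (b j)) y (b k)) (closedBall x σ) :=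
    fun i j k => (hu3 i j k).continuousOn.mono hxU
  have cg1 : ∀ m, ContinuousOn (fun y => fderiv ℝ g y (b m)) (closedBall x σ) := fun m =>
    (hg1 m).continuousOn.mono hxU
  have hKc : IsCompact (closedBall x σ) := isCompact_closedBall x σ
  /- ───── the given integrals at `x` ───── -/
  have hP : ∫ y in closedBall x σ, u y ^ 2 ≤ K₀ * r ^ q := by
    have := hI x hxr₁; rwa [← hr, ← hσdef] at this
  have hΓ₀ : ∫ y in closedBall x σ, g y ^ 2 ≤ K * r ^ (-5 : ℝ) := by
    have := (hG x hxr₁).1; rwa [← hr, ← hσdef] at this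
  have hΓ₁ : ∀ m, ∫ y in closedBall x σ, (fderiv ℝ g y (b m)) ^ 2 ≤ K * r ^ (-7 : ℝ) := by
    have := (hG x hxr₁).2.1; rwa [← hr, ← hσdef] at this
  have hg1pt : ∀ m, ∀ y ∈ closedBall x σ, |fderiv ℝ g y (b m)| ≤ K * r ^ (-5 : ℝ) := by
    have := (hG x hxr₁).2.2; rwa [← hr, ← hσdef] at this
  have hP0 : 0 ≤ ∫ y in closedBall x σ, u y ^ 2 :=
    setIntegral_nonneg measurableSet_closedBall fun y _ => sq_nonneg _
  /- ───── the `L` identities ───── -/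
  have hL2 : (M / σ) ^ 2 = (M / θ) ^ 2 * r ^ (-2 : ℝ) := by
    rw [hL, mul_pow, ← Real.rpow_natCast (r ^ (-1 : ℝ)), ← Real.rpow_mul hr0.le]; norm_num
  have hL4 : (M / σ) ^ 4 = (M / θ) ^ 4 * r ^ (-4 : ℝ) := by
    rw [hL, mul_pow, ← Real.rpow_natCast (r ^ (-1 : ℝ)), ← Real.rpow_mul hr0.le]; norm_num
  have hMθ0 : 0 < M / θ := div_pos hM hθ
  have hL2inv : ((M / σ) ^ 2)⁻¹ = (θ / M) ^ 2 * r ^ (2 : ℝ) := by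
    rw [hL2, mul_inv, ← Real.rpow_neg hr0.le, neg_neg, ← inv_pow, inv_div]
  /- ═════ level zero ═════ -/
  obtain ⟨hE₁, hE₂, hsup₀⟩ := level_zero_ball hMC hU hσ hxU hu hg hε0 hε heq ha'
    (fun y hy => (hβ_ball y hy).trans hΛ₁L) (fun y hy => (hc_ball y hy).trans hΛ₂L)
  -- the two inputs of the crude bounds
  have hin1 : (M / σ) ^ 2 * (∫ y in closedBall x σ, u y ^ 2) ≤ (M / θ) ^ 2 * K₀ * r ^ (q - 2) := by
    rw [hL2]
    calc (M / θ) ^ 2 * r ^ (-2 : ℝ) * ∫ y in closedBall x σ, u y ^ 2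
        ≤ (M / θ) ^ 2 * r ^ (-2 : ℝ) * (K₀ * r ^ q) :=
          mul_le_mul_of_nonneg_left hP (by positivity)
      _ = (M / θ) ^ 2 * K₀ * (r ^ (-2 : ℝ) * r ^ q) := by ring
      _ = (M / θ) ^ 2 * K₀ * r ^ (q - 2) := by rw [hpw]; ring_nf
  have hin2 : (∫ y in closedBall x σ, g y ^ 2) / (M / σ) ^ 2 ≤ K * (θ / M) ^ 2 * r ^ (q - 2) := by
    rw [div_eq_mul_inv, hL2inv]
    calc (∫ y in closedBall x σ, g y ^ 2) * ((θ / M) ^ 2 * r ^ (2 : ℝ))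
        ≤ K * r ^ (-5 : ℝ) * ((θ / M) ^ 2 * r ^ (2 : ℝ)) :=
          mul_le_mul_of_nonneg_right hΓ₀ (by positivity)
      _ = K * (θ / M) ^ 2 * (r ^ (-5 : ℝ) * r ^ (2 : ℝ)) := by ring
      _ = K * (θ / M) ^ 2 * r ^ (-3 : ℝ) := by rw [hpw]; norm_num
      _ ≤ K * (θ / M) ^ 2 * r ^ (q - 2) :=
          mul_le_mul_of_nonneg_left (hmo (by linarith only [hq])) (by positivity)
  have hin3 : (M / σ) ^ 4 * (∫ y in closedBall x σ, u y ^ 2) ≤ (M / θ) ^ 4 * K₀ * r ^ (q - 4) := by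
    rw [hL4]
    calc (M / θ) ^ 4 * r ^ (-4 : ℝ) * ∫ y in closedBall x σ, u y ^ 2
        ≤ (M / θ) ^ 4 * r ^ (-4 : ℝ) * (K₀ * r ^ q) :=
          mul_le_mul_of_nonneg_left hP (by positivity)
      _ = (M / θ) ^ 4 * K₀ * (r ^ (-4 : ℝ) * r ^ q) := by ring
      _ = (M / θ) ^ 4 * K₀ * r ^ (q - 4) := by rw [hpw]; ring_nf
  have hin4 : (∫ y in closedBall x σ, g y ^ 2) ≤ K * r ^ (q - 4) :=
    hΓ₀.trans (mul_le_mul_of_nonneg_left (hmo (by linarith only [hq])) hK)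
  -- `E₁ ≤ A₁ r^{q-2}`, `E₂ ≤ A₂ r^{q-4}`, `u² ≤ θ A₂ r^{q-3}`
  have hE₁' : ∫ y in ball x (σ / 2), ∑ i, (fderiv ℝ u y (b i)) ^ 2 ≤ A₁ * r ^ (q - 2) := by
    refine hE₁.trans ?_
    rw [hA₁]
    nlinarith only [hin1, hin2, hC0, mul_nonneg hC0 (hrp0 (q - 2)).le]
  have hX₀ : C₀ * ((M / σ) ^ 4 * (∫ y in closedBall x σ, u y ^ 2) + ∫ y in closedBall x σ, g y ^ 2) ≤
      A₂ * r ^ (q - 4) := by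
    rw [hA₂]
    nlinarith only [hin3, hin4, hC0, mul_nonneg hC0 (hrp0 (q - 4)).le]
  have hE₂' : ∫ y in ball x (σ / 2), ∑ i, ∑ j, (fderiv ℝ (fun z => fderiv ℝ u z (b i)) y (b j)) ^ 2 ≤
      A₂ * r ^ (q - 4) := hE₂.trans hX₀
  have hrr : ∀ s : ℝ, r * r ^ s = r ^ (s + 1) := fun s => by
    calc r * r ^ s = r ^ (1 : ℝ) * r ^ s := by rw [Real.rpow_one]
      _ = r ^ (s + 1) := by rw [hpw]; ring_nf
  have hrσ : σ * r ^ (q - 4) = θ * r ^ (q - 3) := by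
    rw [hσdef, mul_assoc, hrr]; ring_nf
  have hsup₀' : u x ^ 2 ≤ θ * A₂ * r ^ (q - 3) := by
    have h := hsup₀ x (mem_closedBall_self (by positivity))
    refine h.trans ?_
    calc C₀ * σ * ((M / σ) ^ 4 * (∫ y in closedBall x σ, u y ^ 2) + ∫ y in closedBall x σ, g y ^ 2)
        = σ * (C₀ * ((M / σ) ^ 4 * (∫ y in closedBall x σ, u y ^ 2) + ∫ y in closedBall x σ, g y ^ 2)) := by
          ring
      _ ≤ σ * (A₂ * r ^ (q - 4)) := mul_le_mul_of_nonneg_left hX₀ hσ.le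
      _ = θ * A₂ * r ^ (q - 3) := by rw [← mul_assoc, mul_comm σ A₂, mul_assoc, hrσ]; ring
  /- ───── integrals on smaller balls ───── -/
  have hsub₁ : closedBall x (σ / 2) ⊆ closedBall x σ := closedBall_subset_closedBall (by linarith only [hσ])
  have hsub₂ : closedBall x (σ / 4) ⊆ closedBall x σ := closedBall_subset_closedBall (by linarith only [hσ])
  have hsub₂₁ : closedBall x (σ / 4) ⊆ closedBall x (σ / 2) :=
    closedBall_subset_closedBall (by linarith only [hσ])
  have hK₁ : IsCompact (closedBall x (σ / 2)) := isCompact_closedBall x _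
  have hK₂ : IsCompact (closedBall x (σ / 4)) := isCompact_closedBall x _
  -- `∫_{B̄(σ/2)} ΣΣ(∂∂u)² ≤ A₂ r^{q-4}`, `∫_{B̄(σ/2)} Σ(∂u)² ≤ A₁ r^{q-2}`, `∫_{B̄ ρ} u² ≤ K₀ r^q`
  have hI2half : ∫ y in closedBall x (σ / 2), ∑ i, ∑ j,
      (fderiv ℝ (fun z => fderiv ℝ u z (b i)) y (b j)) ^ 2 ≤ A₂ * r ^ (q - 4) := by
    rw [setIntegral_closedBall_eq_ball]; exact hE₂'
  have hI1half : ∫ y in closedBall x (σ / 2), ∑ i, (fderiv ℝ u y (b i)) ^ 2 ≤ A₁ * r ^ (q - 2) := by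
    rw [setIntegral_closedBall_eq_ball]; exact hE₁'
  have hI0sub : ∀ {s : Set E3}, s ⊆ closedBall x σ → ∫ y in s, u y ^ 2 ≤ K₀ * r ^ q := fun hs =>
    (setIntegral_le_setIntegral_of_le hKc hs (cu0.pow 2) (cu0.pow 2) (fun y _ => sq_nonneg _)
      (fun y _ => le_rfl)).trans hP
  -- single terms against sums, on sub-balls of `B̄(σ/2)`
  have hI1single : ∀ {s : Set E3}, s ⊆ closedBall x (σ / 2) → ∀ m,
      ∫ y in s, (fderiv ℝ u y (b m)) ^ 2 ≤ A₁ * r ^ (q - 2) := by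
    intro s hs m
    refine (setIntegral_le_setIntegral_of_le hK₁ hs ((cu1 m).mono hsub₁ |>.pow 2)
      (continuousOn_finsetSum _ fun i _ => ((cu1 i).mono hsub₁).pow 2) (fun y _ => sq_nonneg _)
      (fun y _ => ?_)).trans hI1half
    exact Finset.single_le_sum (f := fun i => (fderiv ℝ u y (b i)) ^ 2) (fun i _ => sq_nonneg _)
      (Finset.mem_univ m)
  have hI2single : ∀ {s : Set E3}, s ⊆ closedBall x (σ / 2) → ∀ m n,
      ∫ y in s, (fderiv ℝ (fun z => fderiv ℝ u z (b m)) y (b n)) ^ 2 ≤ A₂ * r ^ (q - 4) := by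
    intro s hs m n
    refine (setIntegral_le_setIntegral_of_le hK₁ hs (((cu2 m n).mono hsub₁).pow 2)
      (continuousOn_finsetSum _ fun i _ => continuousOn_finsetSum _ fun j _ =>
        ((cu2 i j).mono hsub₁).pow 2) (fun y _ => sq_nonneg _) (fun y _ => ?_)).trans hI2half
    calc (fderiv ℝ (fun z => fderiv ℝ u z (b m)) y (b n)) ^ 2
        ≤ ∑ j, (fderiv ℝ (fun z => fderiv ℝ u z (b m)) y (b j)) ^ 2 :=
          Finset.single_le_sum (f := fun j => (fderiv ℝ (fun z => fderiv ℝ u z (b m)) y (b j)) ^ 2)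
            (fun j _ => sq_nonneg _) (Finset.mem_univ n)
      _ ≤ ∑ i, ∑ j, (fderiv ℝ (fun z => fderiv ℝ u z (b i)) y (b j)) ^ 2 :=
          Finset.single_le_sum (f := fun i => ∑ j, (fderiv ℝ (fun z => fderiv ℝ u z (b i)) y (b j)) ^ 2)
            (fun i _ => Finset.sum_nonneg fun j _ => sq_nonneg _) (Finset.mem_univ m)
  have hI2sub : ∀ {s : Set E3}, s ⊆ closedBall x (σ / 2) →
      ∫ y in s, ∑ i, ∑ j, (fderiv ℝ (fun z => fderiv ℝ u z (b i)) y (b j)) ^ 2 ≤ A₂ * r ^ (q - 4) := by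
    intro s hs
    refine (setIntegral_le_setIntegral_of_le hK₁ hs ?_ ?_
      (fun y _ => Finset.sum_nonneg fun i _ => Finset.sum_nonneg fun j _ => sq_nonneg _)
      (fun y _ => le_rfl)).trans hI2half <;>
    exact continuousOn_finsetSum _ fun i _ => continuousOn_finsetSum _ fun j _ =>
      ((cu2 i j).mono hsub₁).pow 2
  have hI1sub : ∀ {s : Set E3}, s ⊆ closedBall x (σ / 2) →
      ∫ y in s, ∑ i, (fderiv ℝ u y (b i)) ^ 2 ≤ A₁ * r ^ (q - 2) := by
    intro s hs
    refine (setIntegral_le_setIntegral_of_le hK₁ hs ?_ ?_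
      (fun y _ => Finset.sum_nonneg fun i _ => sq_nonneg _) (fun y _ => le_rfl)).trans hI1half <;>
    exact continuousOn_finsetSum _ fun i _ => ((cu1 i).mono hsub₁).pow 2
  -- the `Q₀` integral on sub-balls of `B̄(σ/2)`
  have hQ0 : ∀ {s : Set E3}, s ⊆ closedBall x (σ / 2) → MeasurableSet s →
      ∫ y in s, (∑ i, ∑ j, (fderiv ℝ (fun z => fderiv ℝ u z (b i)) y (b j)) ^ 2
        + ∑ i, (fderiv ℝ u y (b i)) ^ 2 + u y ^ 2) ≤ (A₂ + A₁ + K₀) * r ^ q := by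
    intro s hs hsm
    have hint : ∀ {f : E3 → ℝ}, ContinuousOn f (closedBall x σ) → IntegrableOn f s := fun hf =>
      ((hf.mono hsub₁).integrableOn_compact hK₁).mono_set hs
    have c2 : ContinuousOn (fun y => ∑ i, ∑ j, (fderiv ℝ (fun z => fderiv ℝ u z (b i)) y (b j)) ^ 2)
        (closedBall x σ) :=
      continuousOn_finsetSum _ fun i _ => continuousOn_finsetSum _ fun j _ => (cu2 i j).pow 2
    have c1 : ContinuousOn (fun y => ∑ i, (fderiv ℝ u y (b i)) ^ 2) (closedBall x σ) :=
      continuousOn_finsetSum _ fun i _ => (cu1 i).pow 2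
    have c0 : ContinuousOn (fun y => u y ^ 2) (closedBall x σ) := cu0.pow 2
    have i2 : IntegrableOn (fun y => ∑ i, ∑ j, (fderiv ℝ (fun z => fderiv ℝ u z (b i)) y (b j)) ^ 2) s :=
      hint c2
    have i1 : IntegrableOn (fun y => ∑ i, (fderiv ℝ u y (b i)) ^ 2) s := hint c1
    have i0 : IntegrableOn (fun y => u y ^ 2) s := hint c0
    have i21 : IntegrableOn (fun y => ∑ i, ∑ j, (fderiv ℝ (fun z => fderiv ℝ u z (b i)) y (b j)) ^ 2
        + ∑ i, (fderiv ℝ u y (b i)) ^ 2) s := i2.add i1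
    rw [integral_add i21 i0, integral_add i2 i1]
    have h2 := hI2sub hs
    have h1 := hI1sub hs
    have h0 := hI0sub (hs.trans hsub₁)
    have m4 : r ^ (q - 4) ≤ r ^ q := hmo (by linarith only [])
    have m2 : r ^ (q - 2) ≤ r ^ q := hmo (by linarith only [])
    nlinarith only [h2, h1, h0, m4, m2, hA₂0, hA₁0, mul_le_mul_of_nonneg_left m4 hA₂0,
      mul_le_mul_of_nonneg_left m2 hA₁0]
  -- the right-hand side integrals on sub-balls
  have hΓ₁sub : ∀ {s : Set E3}, s ⊆ closedBall x σ → ∀ m,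
      ∫ y in s, (fderiv ℝ g y (b m)) ^ 2 ≤ K * r ^ (-7 : ℝ) := fun hs m =>
    (setIntegral_le_setIntegral_of_le hKc hs ((cg1 m).pow 2) ((cg1 m).pow 2)
      (fun y _ => sq_nonneg _) (fun y _ => le_rfl)).trans (hΓ₁ m)
  -- squares of `Λ₁`, `Λ₂`
  have hΛ₁sq : Λ₁ ^ 2 = 9 * K ^ 2 * r ^ (-6 : ℝ) := by
    rw [hΛ₁def, mul_pow, mul_pow, ← Real.rpow_natCast (r ^ (-3 : ℝ)), ← Real.rpow_mul hr0.le]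
    norm_num
  have hΛ₂sq : Λ₂ ^ 2 = 16 * K ^ 2 * r ^ (-8 : ℝ) := by
    rw [hΛ₂def, mul_pow, mul_pow, ← Real.rpow_natCast (r ^ (-4 : ℝ)), ← Real.rpow_mul hr0.le]
    norm_num
  /- ═════ level one ═════ -/
  have hσ₁ : 0 < σ / 2 := by linarith only [hσ]
  have hxU₁ : closedBall x (σ / 2) ⊆ U := hsub₁.trans hxU
  have hLm₁ : M / σ ≤ M / (σ / 2) := hMσ_mono hσ₁ (by linarith only [hσ])
  have hL₁eq : M / (σ / 2) = 2 * (M / σ) := by field_simp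
  have hlev1 : ∀ m,
      (∫ y in ball x (σ / 2 / 2), ∑ i, ∑ j, (fderiv ℝ (fun z => fderiv ℝ
          (fun z' => fderiv ℝ u z' (b m)) z (b i)) y (b j)) ^ 2) ≤ A₃ * r ^ (q - 6) ∧
      (∫ y in ball x (σ / 2 / 2), ∑ i, (fderiv ℝ (fun z => fderiv ℝ u z (b m)) y (b i)) ^ 2)
          ≤ A₄ * r ^ (q - 4) ∧
      (fderiv ℝ u x (b m)) ^ 2 ≤ A₃ * r ^ (q - 5) := by
    intro m
    obtain ⟨hE11, hE21, hsup₁⟩ := level_one_ball hC0 hM hMC hU hσ₁ hxU₁ hu hg has hβs hcs hε0 hε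
      heq (fun y hy => ha' y (hsub₁ hy))
      (fun y hy => (hβ_ball y (hsub₁ hy)).trans (hΛ₁L.trans hLm₁))
      (fun y hy => (hc_ball y (hsub₁ hy)).trans (hΛ₂L.trans
        (pow_le_pow_left₀ (div_pos hM hσ).le hLm₁ 2)))
      (fun y hy i => hΛ₁' y (hsub₁ hy) i) m
    -- inputs
    have hP₁ : ∫ y in closedBall x (σ / 2), (fderiv ℝ u y (b m)) ^ 2 ≤ A₁ * r ^ (q - 2) :=
      hI1single Subset.rfl m
    have hP₁0 : 0 ≤ ∫ y in closedBall x (σ / 2), (fderiv ℝ u y (b m)) ^ 2 :=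
      setIntegral_nonneg measurableSet_closedBall fun y _ => sq_nonneg _
    have hΓ₁' : 2 * (∫ y in closedBall x (σ / 2), (fderiv ℝ g y (b m)) ^ 2)
        + 54 * Λ₁ ^ 2 * (∫ y in closedBall x (σ / 2),
          (∑ i, ∑ j, (fderiv ℝ (fun z => fderiv ℝ u z (b i)) y (b j)) ^ 2
            + ∑ i, (fderiv ℝ u y (b i)) ^ 2 + u y ^ 2)) ≤ B₁ * r ^ (q - 6) := by
      have h1 := hΓ₁sub hsub₁ m
      have h2 := hQ0 Subset.rfl measurableSet_closedBall
      have m7 : r ^ (-7 : ℝ) ≤ r ^ (q - 6) := hmo (by linarith only [hq])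
      have e6 : r ^ (-6 : ℝ) * r ^ q = r ^ (q - 6) := by rw [hpw]; ring_nf
      rw [hΛ₁sq, hB₁]
      have h3 : 54 * (9 * K ^ 2 * r ^ (-6 : ℝ)) * (∫ y in closedBall x (σ / 2),
            (∑ i, ∑ j, (fderiv ℝ (fun z => fderiv ℝ u z (b i)) y (b j)) ^ 2
              + ∑ i, (fderiv ℝ u y (b i)) ^ 2 + u y ^ 2)) ≤
          486 * K ^ 2 * (A₂ + A₁ + K₀) * r ^ (q - 6) := by
        have := mul_le_mul_of_nonneg_left h2 (by positivity : (0:ℝ) ≤ 486 * K ^ 2 * r ^ (-6 : ℝ))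
        rw [← e6]
        nlinarith only [this]
      nlinarith only [h1, h3, m7, hK]
    -- the `L₁` identities
    have hL₁2 : (M / (σ / 2)) ^ 2 = 4 * (M / θ) ^ 2 * r ^ (-2 : ℝ) := by rw [hL₁eq, mul_pow, hL2]; ring
    have hL₁4 : (M / (σ / 2)) ^ 4 = 16 * (M / θ) ^ 4 * r ^ (-4 : ℝ) := by rw [hL₁eq, mul_pow, hL4]; ring
    have hL₁2inv : ((M / (σ / 2)) ^ 2)⁻¹ = (θ / M) ^ 2 * r ^ (2 : ℝ) / 4 := by
      rw [hL₁eq, mul_pow, mul_inv, hL2inv]; ring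
    -- outputs
    have hΓ₁'0 : 0 ≤ B₁ * r ^ (q - 6) := mul_nonneg hB₁0 (hrp0 _).le
    have hX₁ : C₀ * ((M / (σ / 2)) ^ 4 * (∫ y in closedBall x (σ / 2), (fderiv ℝ u y (b m)) ^ 2)
        + (2 * (∫ y in closedBall x (σ / 2), (fderiv ℝ g y (b m)) ^ 2)
          + 54 * Λ₁ ^ 2 * ∫ y in closedBall x (σ / 2),
            (∑ i, ∑ j, (fderiv ℝ (fun z => fderiv ℝ u z (b i)) y (b j)) ^ 2
              + ∑ i, (fderiv ℝ u y (b i)) ^ 2 + u y ^ 2))) ≤ A₃ * r ^ (q - 6) := by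
      have e : r ^ (-4 : ℝ) * r ^ (q - 2) = r ^ (q - 6) := by rw [hpw]; ring_nf
      have h1 : (M / (σ / 2)) ^ 4 * (∫ y in closedBall x (σ / 2), (fderiv ℝ u y (b m)) ^ 2) ≤
          16 * (M / θ) ^ 4 * A₁ * r ^ (q - 6) := by
        rw [hL₁4, ← e]
        have := mul_le_mul_of_nonneg_left hP₁ (by positivity : (0:ℝ) ≤ 16 * (M / θ) ^ 4 * r ^ (-4 : ℝ))
        nlinarith only [this]
      rw [hA₃]
      nlinarith only [h1, hΓ₁', hC0, mul_nonneg hC0 (hrp0 (q - 6)).le]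
    have hX₁' : C₀ * ((M / (σ / 2)) ^ 2 * (∫ y in closedBall x (σ / 2), (fderiv ℝ u y (b m)) ^ 2)
        + (2 * (∫ y in closedBall x (σ / 2), (fderiv ℝ g y (b m)) ^ 2)
          + 54 * Λ₁ ^ 2 * ∫ y in closedBall x (σ / 2),
            (∑ i, ∑ j, (fderiv ℝ (fun z => fderiv ℝ u z (b i)) y (b j)) ^ 2
              + ∑ i, (fderiv ℝ u y (b i)) ^ 2 + u y ^ 2)) / (M / (σ / 2)) ^ 2) ≤ A₄ * r ^ (q - 4) := by
      have e : r ^ (-2 : ℝ) * r ^ (q - 2) = r ^ (q - 4) := by rw [hpw]; ring_nf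
      have e' : r ^ (q - 6) * r ^ (2 : ℝ) = r ^ (q - 4) := by rw [hpw]; ring_nf
      have h1 : (M / (σ / 2)) ^ 2 * (∫ y in closedBall x (σ / 2), (fderiv ℝ u y (b m)) ^ 2) ≤
          4 * (M / θ) ^ 2 * A₁ * r ^ (q - 4) := by
        rw [hL₁2, ← e]
        have := mul_le_mul_of_nonneg_left hP₁ (by positivity : (0:ℝ) ≤ 4 * (M / θ) ^ 2 * r ^ (-2 : ℝ))
        nlinarith only [this]
      have h2 : (2 * (∫ y in closedBall x (σ / 2), (fderiv ℝ g y (b m)) ^ 2)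
          + 54 * Λ₁ ^ 2 * ∫ y in closedBall x (σ / 2),
            (∑ i, ∑ j, (fderiv ℝ (fun z => fderiv ℝ u z (b i)) y (b j)) ^ 2
              + ∑ i, (fderiv ℝ u y (b i)) ^ 2 + u y ^ 2)) / (M / (σ / 2)) ^ 2 ≤
          B₁ * (θ / M) ^ 2 / 4 * r ^ (q - 4) := by
        rw [div_eq_mul_inv, hL₁2inv, ← e']
        have := mul_le_mul_of_nonneg_right hΓ₁' (by positivity : (0:ℝ) ≤ (θ / M) ^ 2 * r ^ (2 : ℝ) / 4)
        nlinarith only [this]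
      rw [hA₄]
      nlinarith only [h1, h2, hC0, mul_nonneg hC0 (hrp0 (q - 4)).le]
    refine ⟨hE21.trans hX₁, hE11.trans hX₁', ?_⟩
    have hxm : x ∈ closedBall x (σ / 2 / 2) := mem_closedBall_self (by positivity)
    refine (hsup₁ x hxm).trans ?_
    have e : σ / 2 * r ^ (q - 6) = θ / 2 * r ^ (q - 5) := by
      rw [hσdef]
      have := hrr (q - 6)
      calc θ * r / 2 * r ^ (q - 6) = θ / 2 * (r * r ^ (q - 6)) := by ring
        _ = θ / 2 * r ^ (q - 5) := by rw [this]; ring_nf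
    calc C₀ * (σ / 2) * ((M / (σ / 2)) ^ 4 * (∫ y in closedBall x (σ / 2), (fderiv ℝ u y (b m)) ^ 2)
          + (2 * (∫ y in closedBall x (σ / 2), (fderiv ℝ g y (b m)) ^ 2)
            + 54 * Λ₁ ^ 2 * ∫ y in closedBall x (σ / 2),
              (∑ i, ∑ j, (fderiv ℝ (fun z => fderiv ℝ u z (b i)) y (b j)) ^ 2
                + ∑ i, (fderiv ℝ u y (b i)) ^ 2 + u y ^ 2)))
        = σ / 2 * (C₀ * ((M / (σ / 2)) ^ 4 * (∫ y in closedBall x (σ / 2), (fderiv ℝ u y (b m)) ^ 2)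
          + (2 * (∫ y in closedBall x (σ / 2), (fderiv ℝ g y (b m)) ^ 2)
            + 54 * Λ₁ ^ 2 * ∫ y in closedBall x (σ / 2),
              (∑ i, ∑ j, (fderiv ℝ (fun z => fderiv ℝ u z (b i)) y (b j)) ^ 2
                + ∑ i, (fderiv ℝ u y (b i)) ^ 2 + u y ^ 2)))) := by ring
      _ ≤ σ / 2 * (A₃ * r ^ (q - 6)) := mul_le_mul_of_nonneg_left hX₁ hσ₁.le
      _ = θ / 2 * A₃ * r ^ (q - 5) := by
          calc σ / 2 * (A₃ * r ^ (q - 6)) = A₃ * (σ / 2 * r ^ (q - 6)) := by ring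
            _ = θ / 2 * A₃ * r ^ (q - 5) := by rw [e]; ring
      _ ≤ A₃ * r ^ (q - 5) := by
          have : θ / 2 ≤ 1 := by linarith only [hθ4]
          have h0 : 0 ≤ A₃ * r ^ (q - 5) := mul_nonneg hA₃0 (hrp0 _).le
          nlinarith only [this, h0]
  /- ═════ level two (the `L⁶` step) ═════ -/
  have hεε₁ : ε ≤ ε₁ := by
    have h1 : r ^ (-2 : ℝ) ≤ r ^ (-1 : ℝ) := hmo (by norm_num)
    have h2 : 2 * K * r ^ (-2 : ℝ) ≤ 2 * K * r ^ (-1 : ℝ) := mul_le_mul_of_nonneg_left h1 (by positivity)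
    have h3 : 2 * K * r ^ (-1 : ℝ) ≤ ε₁ := by
      rw [hrm1, ← div_eq_mul_inv, div_le_iff₀ hr0]
      rw [div_le_iff₀ hε₁] at hrε
      linarith only [hrε]
    rw [hεdef]
    exact h2.trans h3
  have e4 : θ * r / 4 = σ / 4 := by rw [hσdef]
  have e8 : θ * r / 8 = σ / 8 := by rw [hσdef]
  have e24 : σ / 2 / 2 = σ / 4 := by ring
  have hsub₈ : closedBall x (σ / 8) ⊆ closedBall x σ := closedBall_subset_closedBall (by linarith only [hσ])
  have hsub₄₁ : closedBall x (σ / 4) ⊆ closedBall x (σ / 2) :=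
    closedBall_subset_closedBall (by linarith only [hσ])
  have hlev2 : ∀ m n, (fderiv ℝ (fun z => fderiv ℝ u z (b m)) x (b n)) ^ 2 ≤ A₅ * r ^ (q - 7) := by
    intro m n
    refine hA₅ U x r q ε u g a β c hU hr1 hq hε0 hεε₁ (by rw [e4]; exact hsub₂.trans hxU) hu hg has
      hβs hcs heq (fun y hy => ha' y (hsub₈ (by rwa [e8] at hy)))
      (fun y hy => ?_) (fun y hy => ?_) (fun y hy i => ?_) (fun m' y hy => ?_) (fun m' => ?_) ?_ ?_ ?_ m n
    · rw [e8] at hy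
      have h := (hβ_ball y (hsub₈ hy)).trans hΛ₁L
      rwa [hσdef] at h
    · rw [e8] at hy
      have h := (hc_ball y (hsub₈ hy)).trans hΛ₂L
      rwa [hσdef] at h
    · rw [e8] at hy
      have h := hΛ₁' y (hsub₈ hy) i
      rwa [hΛ₁def] at h
    · rw [e8] at hy
      exact hg1pt m' y (hsub₈ hy)
    · have h := (hlev1 m').1
      rw [e24, ← setIntegral_closedBall_eq_ball] at h
      rwa [e4]
    · rw [e4]; exact hI2sub hsub₄₁
    · rw [e4]; exact hI1sub hsub₄₁
    · rw [e4]; exact hI0sub (hsub₄₁.trans hsub₁)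
  /- ═════ conclusion ═════ -/
  have hθ1 : θ ≤ 1 := by linarith only [hθ4]
  refine ⟨?_, fun m => ?_, fun m n => (hlev2 m n).trans ?_⟩
  · have h0 : 0 ≤ r ^ (q - 3) := (hrp0 _).le
    have h1 := mul_le_mul_of_nonneg_right hθ1 (mul_nonneg hA₂0 h0)
    have h2 : 0 ≤ A₃ * r ^ (q - 3) := mul_nonneg hA₃0 h0
    have h3 : 0 ≤ A₅ * r ^ (q - 3) := mul_nonneg hA₅0 h0
    nlinarith only [hsup₀', h1, h2, h3]
  · have h0 : 0 ≤ r ^ (q - 5) := (hrp0 _).le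
    nlinarith only [(hlev1 m).2.2, h0, hA₂0, hA₃0, hA₅0]
  · have h0 : 0 ≤ r ^ (q - 7) := (hrp0 _).le
    nlinarith only [h0, hA₂0, hA₃0, hA₅0]

end Bootstrap



end Literature.Analysis.PDE
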